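import Literature.Analysis.FunctionSpaces.PVToolkit
import Literature.Computability.Complexity.FlatRuns
import Literature.Computability.Complexity.TM2PassThrough
import Literature.Computability.Complexity.FoldBricks
import HarnessLib

/-!
# Cobham's theorem for `PV` function symbols over Mathlib's `TM2` model — proofs

Sibling proof file of `PVFunctions.lean` (D-0014: the named fact `cobham : Prop` stated there is
discharged here as `cobham_holds : cobham`).

## Part I. A semantic calculus of `PV`-definable functions (Cook 1975, §2; Cobham 1965)

`IsPVDefinable F` (`F : (Fin n → ℕ) → ℕ` is the interpretation of a `PV` symbol) is closed under
substitution of `PV`-definable functions into the initial functions, and under *limited recursion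
on notation* in the following untruncated form (`IsPVDefinable.of_limRec`): if `f (x⃗, 0) = g x⃗`,
`f (x⃗, s_b y) = h_b (x⃗, y, f (x⃗, y))` and `f ≤ k` pointwise with `g, h_b, k` definable, then
`f` is definable (the truncations by `min` in `PVFun.eval` are then the identity). From this we
derive Cook's first `PV` functions (Cook 1975, §2): numerals, parity, `MSP`/`LSP`
(`u ↦ ⌊u / 2^{|v|}⌋`, `u ↦ u mod 2^{|v|}`), `2^{|v|}`, functions of the low `w` bits, definition
by cases on the value of an argument, and base-`2^w` digit stacks (`push`/`pop`).

## Part II. Arithmetisation of flat programs (Cobham 1965, "only if"; Cook–Nguyen 2010,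
Thm. VI.2.12 `⟹`, eq. (100))

The tree reduces every bundled `TM2` machine to a *flat program* (`FlatProg`, `FlatRuns.lean`:
`FlatProg.flat_complete`) acting on `ℕ × List (List ℕ)`. We code a stack `l` of symbol numbers
as the number `stkNum w l = 2^{w|l|} + Σᵢ (lᵢ + 2) 2^{w i}` (sentinel digit `1`, digits `≥ 2`),
a configuration as the tuple `(pc, stkNum S₀, …)` packed in base `2^{L}`, and show that one
flat step, the initial configuration of the input `n`, the clocked run and the read-out of the
output numeral are `PV`-definable (`Conf_M` by limited recursion on notation on a clock of
length `≥ p(|n|) · haltAddr`, then `Out_M`; Cook–Nguyen 2010, proof sketch of Thm. VI.2.12).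

## Part III. Every `PV` symbol is polynomial time (Cobham 1965, "if"; Cook–Nguyen 2010,
Thm. VI.2.12 `⟸`)

By induction on symbols, through the tree's algebra of `FP` string functions
(`BrickAlgebra.lean`, `FoldBricks.lean`, `PlumbingBricks.lean`, `StackBricks*.lean`): tuples are
records of numerals (`PVPoly.codeVec`), the initial symbols are bricks (`addFn`, `prodFn`,
`lenBinF`, …; `#` is a counted loop appending zeros), composition is `tupleF`, and limited
recursion on notation is a counted loop `Brick.loopStep` over the bits of the recursion argument,
most significant first, the accumulator being renormalised and clipped to the (polynomial) length
of the bound `k` (`PVPoly.OnCodes.limRec`).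

Main results: `FlatSim.isPVDefinable_of_polyTimeComputable` ("only if"),
`polyTimeComputable_of_isPVDefinable` ("if"), `cobham_holds : cobham`.

Not here: the `n`-ary form of the theorem (polynomial-time tupling), and the identification of
`IsPVDefinable` with `Σᵇ₁`-definability in `S₂¹` (`isPVDefinable_iff_isSigmabDefinable`, which
needs Buss's witnessing theorem).

## References

* A. Cobham, *The intrinsic computational difficulty of functions*, Proc. 1964 Int. Congress
  Logic, Methodology and Philosophy of Science, North-Holland 1965, 24–30 (the theorem; not held,
  statement as printed in Krajíček 1995, Thm. 5.3.1).
* J. Krajíček, *Bounded Arithmetic, Propositional Logic, and Complexity Theory*, CUP 1995,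
  Thm. 5.3.1 (Cobham's theorem, stated), Def. 5.3.2 (Cook's `PV`).
* S. Cook, P. Nguyen, *Logical Foundations of Proof Complexity*, CUP 2010, Thm. VI.2.12 and its
  proof sketch (`Init_M`, `Next_M`, `Out_M`, `Conf_M` by limited recursion, eq. (100)).
* S. A. Cook, *Feasibly constructive proofs and the propositional calculus*, STOC 1975, §2
  (the first derived functions of `PV`).
-/

namespace Literature.Analysis.FunctionSpaces

open _root_.Computability Literature.Computability.Complexity

/-! ## Part I. The semantic calculus -/

namespace IsPVDefinable

variable {n : ℕ}

/-- Substitution into a unary definable function. [cite: Cobham1965] -/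
theorem app₁ {F : ℕ → ℕ} (hF : IsPVDefinable fun v : Fin 1 → ℕ => F (v 0))
    {g : (Fin n → ℕ) → ℕ} (hg : IsPVDefinable g) : IsPVDefinable fun v => F (g v) :=
  hF.comp (G := fun _ => g) fun _ => hg

/-- Substitution into a binary definable function. [cite: Cobham1965] -/
theorem app₂ {F : ℕ → ℕ → ℕ} (hF : IsPVDefinable fun v : Fin 2 → ℕ => F (v 0) (v 1))
    {g h : (Fin n → ℕ) → ℕ} (hg : IsPVDefinable g) (hh : IsPVDefinable h) :
    IsPVDefinable fun v => F (g v) (h v) := by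
  have := hF.comp (G := ![g, h]) (fun i => by fin_cases i <;> assumption)
  simpa using this

/-- Substitution into a ternary definable function. [cite: Cobham1965] -/
theorem app₃ {F : ℕ → ℕ → ℕ → ℕ} (hF : IsPVDefinable fun v : Fin 3 → ℕ => F (v 0) (v 1) (v 2))
    {g h l : (Fin n → ℕ) → ℕ} (hg : IsPVDefinable g) (hh : IsPVDefinable h)
    (hl : IsPVDefinable l) : IsPVDefinable fun v => F (g v) (h v) (l v) := by
  have := hF.comp (G := ![g, h, l]) (fun i => by fin_cases i <;> assumption)
  simpa using this

/-- Two functions that agree everywhere are definable together. [folklore] -/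
theorem congr {f g : (Fin n → ℕ) → ℕ} (hf : IsPVDefinable f) (h : ∀ v, f v = g v) :
    IsPVDefinable g := by
  have : f = g := funext h
  rwa [this] at hf

/-- General conditional on a definable test being `0`, with arbitrary propositions decided by it:
if `P v ↔ t v = 0` then `v ↦ if P v then a v else b v` is definable. [folklore] -/
theorem ite_of_iff {P : (Fin n → ℕ) → Prop} [DecidablePred P] {t a b : (Fin n → ℕ) → ℕ}
    (ht : IsPVDefinable t) (ha : IsPVDefinable a) (hb : IsPVDefinable b)
    (hP : ∀ v, P v ↔ t v = 0) : IsPVDefinable fun v => if P v then a v else b v :=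
  (cond ht ha hb).congr fun v => by
    by_cases h : P v
    · rw [if_pos ((hP v).1 h), if_pos h]
    · rw [if_neg (fun h' => h ((hP v).2 h')), if_neg h]

/-- **Limited recursion on notation, untruncated form** (Cobham 1965; Cook 1975, §2): if
`f (x⃗, 0) = g x⃗`, `f (x⃗, s_b y) = h_b (x⃗, y, f (x⃗, y))` for `s_b y ≠ 0`, and `f ≤ k`
pointwise, with `g`, `h_b`, `k` definable, then `f` is definable — it is the interpretation of
`limRec g h k`, every truncation `min _ (k _)` being the identity. [cite: Cobham1965] -/
theorem of_limRec {f : (Fin (n + 1) → ℕ) → ℕ} {g : (Fin n → ℕ) → ℕ}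
    {h : Bool → (Fin (n + 2) → ℕ) → ℕ} {k : (Fin (n + 1) → ℕ) → ℕ}
    (hg : IsPVDefinable g) (hh : ∀ b, IsPVDefinable (h b)) (hk : IsPVDefinable k)
    (h0 : ∀ x : Fin n → ℕ, f (Fin.snoc x 0) = g x)
    (hs : ∀ (x : Fin n → ℕ) (b : Bool) (y : ℕ), Nat.bit b y ≠ 0 →
      f (Fin.snoc x (Nat.bit b y)) = h b (Fin.snoc (Fin.snoc x y) (f (Fin.snoc x y))))
    (hle : ∀ (x : Fin n → ℕ) (y : ℕ), f (Fin.snoc x y) ≤ k (Fin.snoc x y)) :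
    IsPVDefinable f := by
  obtain ⟨g', rfl⟩ := hg
  obtain ⟨k', rfl⟩ := hk
  choose h' hh' using hh
  refine ⟨PVFun.limRec g' h' k', funext fun v => ?_⟩
  have hv : v = Fin.snoc (Fin.init v) (v (Fin.last n)) := (Fin.snoc_init_self v).symm
  rw [hv]
  generalize Fin.init v = x
  generalize v (Fin.last n) = y
  induction y using Nat.binaryRec' with
  | zero =>
    rw [PVFun.eval_limRec_zero, h0]
    exact min_eq_left ((h0 x).symm.le.trans (hle x 0))
  | bit b y hy ih =>
    have hby : Nat.bit b y ≠ 0 := fun h0' => by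
      rcases Nat.bit_eq_zero_iff.1 h0' with ⟨rfl, rfl⟩
      exact Bool.false_ne_true (hy rfl)
    rw [PVFun.eval_limRec_bit _ _ _ _ _ _ hy, ih, hh', ← hs x b y hby]
    exact min_eq_left (hle x _)

end IsPVDefinable

/-! ### Curried forms -/

/-- A unary number-theoretic function is `PV`-definable. [cite: Cobham1965] -/
def IsPV₁ (f : ℕ → ℕ) : Prop := IsPVDefinable fun v : Fin 1 → ℕ => f (v 0)

/-- A binary number-theoretic function is `PV`-definable. [cite: Cobham1965] -/
def IsPV₂ (f : ℕ → ℕ → ℕ) : Prop := IsPVDefinable fun v : Fin 2 → ℕ => f (v 0) (v 1)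

/-- A ternary number-theoretic function is `PV`-definable. [cite: Cobham1965] -/
def IsPV₃ (f : ℕ → ℕ → ℕ → ℕ) : Prop := IsPVDefinable fun v : Fin 3 → ℕ => f (v 0) (v 1) (v 2)

namespace IsPV₁

/-- Substitution. [cite: Cobham1965] -/
theorem app {n : ℕ} {F : ℕ → ℕ} (hF : IsPV₁ F) {g : (Fin n → ℕ) → ℕ} (hg : IsPVDefinable g) :
    IsPVDefinable fun v => F (g v) :=
  IsPVDefinable.app₁ hF hg

/-- From a vector-form definability statement. [folklore] -/
theorem of_isPVDefinable {F : ℕ → ℕ} (h : IsPVDefinable fun v : Fin 1 → ℕ => F (v 0)) : IsPV₁ F := h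

/-- Composition of unary functions. [cite: Cobham1965] -/
theorem comp {F G : ℕ → ℕ} (hF : IsPV₁ F) (hG : IsPV₁ G) : IsPV₁ (F ∘ G) :=
  hF.app hG

/-- Iterates of a unary function. [cite: Cobham1965] -/
theorem iterate {F : ℕ → ℕ} (hF : IsPV₁ F) : ∀ m : ℕ, IsPV₁ F^[m]
  | 0 => IsPVDefinable.proj 0
  | m + 1 => by
    rw [Function.iterate_succ']
    exact hF.comp (iterate hF m)

end IsPV₁

/-- Substitution into a binary function. [cite: Cobham1965] -/
theorem IsPV₂.app {n : ℕ} {F : ℕ → ℕ → ℕ} (hF : IsPV₂ F) {g h : (Fin n → ℕ) → ℕ}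
    (hg : IsPVDefinable g) (hh : IsPVDefinable h) : IsPVDefinable fun v => F (g v) (h v) :=
  IsPVDefinable.app₂ hF hg hh

/-- Substitution into a ternary function. [cite: Cobham1965] -/
theorem IsPV₃.app {n : ℕ} {F : ℕ → ℕ → ℕ → ℕ} (hF : IsPV₃ F) {g h l : (Fin n → ℕ) → ℕ}
    (hg : IsPVDefinable g) (hh : IsPVDefinable h) (hl : IsPVDefinable l) :
    IsPVDefinable fun v => F (g v) (h v) (l v) :=
  IsPVDefinable.app₃ hF hg hh hl

/-- `Fin.snoc` into `Fin 1` at `0`. [folklore] -/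
private theorem snoc₀₀ (x : Fin 0 → ℕ) (y : ℕ) : Fin.snoc (α := fun _ => ℕ) x y 0 = y := rfl
/-- `Fin.snoc` into `Fin 2` at `0`. [folklore] -/
private theorem snoc₁₀ (x : Fin 1 → ℕ) (y : ℕ) : Fin.snoc (α := fun _ => ℕ) x y 0 = x 0 := rfl
/-- `Fin.snoc` into `Fin 2` at `1`. [folklore] -/
private theorem snoc₁₁ (x : Fin 1 → ℕ) (y : ℕ) : Fin.snoc (α := fun _ => ℕ) x y 1 = y := rfl
/-- `Fin.snoc` into `Fin 3` at `0`. [folklore] -/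
private theorem snoc₂₀ (x : Fin 2 → ℕ) (y : ℕ) : Fin.snoc (α := fun _ => ℕ) x y 0 = x 0 := rfl
/-- `Fin.snoc` into `Fin 3` at `1`. [folklore] -/
private theorem snoc₂₁ (x : Fin 2 → ℕ) (y : ℕ) : Fin.snoc (α := fun _ => ℕ) x y 1 = x 1 := rfl
/-- `Fin.snoc` into `Fin 3` at `2`. [folklore] -/
private theorem snoc₂₂ (x : Fin 2 → ℕ) (y : ℕ) : Fin.snoc (α := fun _ => ℕ) x y 2 = y := rfl

/-- **Limited recursion on notation without parameters**: `f 0 = c`, `f (s_b y) = h_b (y, f y)`,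
`f ≤ k`. [cite: Cobham1965] -/
theorem IsPV₁.of_limRec {f : ℕ → ℕ} (c : ℕ) {h : Bool → ℕ → ℕ → ℕ} {k : ℕ → ℕ}
    (hh : ∀ b, IsPV₂ (h b)) (hk : IsPV₁ k) (h0 : f 0 = c)
    (hs : ∀ (b : Bool) (y : ℕ), Nat.bit b y ≠ 0 → f (Nat.bit b y) = h b y (f y))
    (hle : ∀ y, f y ≤ k y) : IsPV₁ f := by
  refine IsPVDefinable.of_limRec (n := 0) (f := fun v : Fin 1 → ℕ => f (v 0))
    (g := fun _ => c) (h := fun b v => h b (v 0) (v 1)) (k := fun v => k (v 0))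
    (IsPVDefinable.const c) hh hk ?_ ?_ ?_
  · intro x; simp only [snoc₀₀, h0]
  · intro x b y hby
    simp only [snoc₀₀, snoc₁₁]
    exact hs b y hby
  · intro x y; simp only [snoc₀₀]; exact hle y

/-- **Limited recursion on notation with one parameter**: `f x 0 = g x`,
`f x (s_b y) = h_b (x, y, f x y)`, `f ≤ k`. [cite: Cobham1965] -/
theorem IsPV₂.of_limRec {f : ℕ → ℕ → ℕ} {g : ℕ → ℕ} {h : Bool → ℕ → ℕ → ℕ → ℕ} {k : ℕ → ℕ → ℕ}
    (hg : IsPV₁ g) (hh : ∀ b, IsPV₃ (h b)) (hk : IsPV₂ k) (h0 : ∀ x, f x 0 = g x)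
    (hs : ∀ (x : ℕ) (b : Bool) (y : ℕ), Nat.bit b y ≠ 0 → f x (Nat.bit b y) = h b x y (f x y))
    (hle : ∀ x y, f x y ≤ k x y) : IsPV₂ f := by
  refine IsPVDefinable.of_limRec (n := 1) (f := fun v : Fin 2 → ℕ => f (v 0) (v 1))
    (g := fun v => g (v 0)) (h := fun b v => h b (v 0) (v 1) (v 2)) (k := fun v => k (v 0) (v 1))
    hg hh hk ?_ ?_ ?_
  · intro x; simp only [snoc₁₀, snoc₁₁, h0]
  · intro x b y hby
    simp only [snoc₁₀, snoc₁₁, snoc₂₀, snoc₂₁, snoc₂₂]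
    exact hs _ b y hby
  · intro x y; simp only [snoc₁₀, snoc₁₁]; exact hle _ _

/-! ### Cook's first derived functions -/

namespace IsPV₁

/-- The identity. [folklore] -/
theorem id : IsPV₁ id := IsPVDefinable.proj 0

/-- Constants. [cite: Krajicek1995, Lemma 5.3.3] -/
theorem const (c : ℕ) : IsPV₁ fun _ => c := IsPVDefinable.const c

/-- `s_b`. [cite: Cook1975, §2] -/
theorem bit (b : Bool) : IsPV₁ (Nat.bit b) := IsPVDefinable.bit b (IsPVDefinable.proj 0)

/-- `⌊·/2⌋`. [cite: Cook1975, §2] -/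
theorem half : IsPV₁ fun x => x / 2 := IsPVDefinable.half (IsPVDefinable.proj 0)

/-- `|·|`. [cite: Buss1986, §2.2] -/
theorem len : IsPV₁ Nat.size := IsPVDefinable.len (IsPVDefinable.proj 0)

/-- Predecessor. [cite: Cook1975, §2] -/
theorem pred : IsPV₁ fun x => x - 1 := IsPVDefinable.pred (IsPVDefinable.proj 0)

/-- Extensionality. [folklore] -/
theorem congr {f g : ℕ → ℕ} (hf : IsPV₁ f) (h : ∀ x, f x = g x) : IsPV₁ g :=
  IsPVDefinable.congr hf fun v => h (v 0)

/-- Iterated halving is division by a power of two. [folklore] -/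
theorem iterate_div_two (w x : ℕ) : (fun x => x / 2)^[w] x = x / 2 ^ w := by
  induction w with
  | zero => simp
  | succ w ih => rw [Function.iterate_succ_apply', ih, Nat.div_div_eq_div_mul, ← pow_succ]

/-- `⌊·/2^w⌋` (`w`-fold `TR`). [cite: Cook1975, §2] -/
theorem div_two_pow (w : ℕ) : IsPV₁ fun x => x / 2 ^ w :=
  (half.iterate w).congr (iterate_div_two w)


/-- Parity `x mod 2`, by limited recursion on notation: `par 0 = 0`, `par (s_b y) = b`.
[cite: Cook1975, §2] -/
theorem mod_two : IsPV₁ fun x => x % 2 := by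
  refine IsPV₁.of_limRec 0 (h := fun b _ _ => b.toNat) (k := fun _ => 1)
    (fun b => IsPVDefinable.const _) (IsPV₁.const 1) (by simp) ?_ (fun y => by omega)
  intro b y _
  exact Nat.bit_mod_two b y

/-- `2^{|x|}` (as `x # 1`). [cite: Cook1975, §2] -/
theorem pow_size : IsPV₁ fun x => 2 ^ Nat.size x :=
  (IsPVDefinable.smash (IsPVDefinable.proj 0) (IsPVDefinable.const 1)).congr fun v => by
    simp

end IsPV₁

namespace IsPV₂

/-- Extensionality. [folklore] -/
theorem congr {f g : ℕ → ℕ → ℕ} (hf : IsPV₂ f) (h : ∀ x y, f x y = g x y) : IsPV₂ g :=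
  IsPVDefinable.congr hf fun v => h (v 0) (v 1)

/-- First projection. [folklore] -/
theorem fst : IsPV₂ fun x _ => x := IsPVDefinable.proj 0

/-- Second projection. [folklore] -/
theorem snd : IsPV₂ fun _ y => y := IsPVDefinable.proj 1

/-- A unary definable function of the first argument. [folklore] -/
theorem of_fst {f : ℕ → ℕ} (hf : IsPV₁ f) : IsPV₂ fun x _ => f x := hf.app fst

/-- A unary definable function of the second argument. [folklore] -/
theorem of_snd {f : ℕ → ℕ} (hf : IsPV₁ f) : IsPV₂ fun _ y => f y := hf.app snd

/-- Addition. [cite: Buss1986, §2.2] -/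
theorem add : IsPV₂ (· + ·) := IsPVDefinable.add fst snd

/-- Multiplication. [cite: Buss1986, §2.2] -/
theorem mul : IsPV₂ (· * ·) := IsPVDefinable.mul fst snd

/-- **`MSP`**: `MSP u v = ⌊u / 2^{|v|}⌋`, by limited recursion on notation on `v`
(`MSP u 0 = u`, `MSP u (s_b v) = ⌊MSP u v / 2⌋`, bound `u`). [cite: Cook1975, §2] -/
theorem msp : IsPV₂ fun u v => u / 2 ^ Nat.size v := by
  refine IsPV₂.of_limRec (g := fun u => u) (h := fun _ _ _ r => r / 2) (k := fun u _ => u)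
    IsPV₁.id (fun _ => IsPVDefinable.half (IsPVDefinable.proj 2)) fst (fun x => by simp) ?_
    (fun x y => Nat.div_le_self _ _)
  intro x b y hby
  rw [Nat.size_bit hby, pow_succ, ← Nat.div_div_eq_div_mul]

/-- **`LSP`**: `LSP u v = u mod 2^{|v|}`, by limited recursion on notation on `v`
(`LSP u 0 = 0`, `LSP u (s_b v) = LSP u v + (MSP u v mod 2) · 2^{|v|}`, bound `u`).
[cite: Cook1975, §2] -/
theorem lsp : IsPV₂ fun u v => u % 2 ^ Nat.size v := by
  refine IsPV₂.of_limRec (g := fun _ => 0)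
    (h := fun _ u y r => r + 2 ^ Nat.size y * (u / 2 ^ Nat.size y % 2)) (k := fun u _ => u)
    (IsPV₁.const 0) (fun _ => ?_) fst (fun x => by simp [Nat.mod_one]) ?_ (fun x y => Nat.mod_le _ _)
  · exact IsPVDefinable.add (IsPVDefinable.proj 2)
      (IsPVDefinable.mul (IsPV₁.pow_size.app (IsPVDefinable.proj 1))
        (IsPV₁.mod_two.app (msp.app (IsPVDefinable.proj 0) (IsPVDefinable.proj 1))))
  · intro x b y hby
    rw [Nat.size_bit hby, Nat.mod_pow_succ]

/-- `⌊u / 2^{i |v|}⌋`, the `i`-fold `MSP`. [cite: Cook1975, §2] -/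
theorem msp_pow (i : ℕ) : IsPV₂ fun u v => u / 2 ^ (i * Nat.size v) := by
  induction i with
  | zero => exact fst.congr fun x y => by simp
  | succ i ih =>
    refine IsPV₂.congr (f := fun x y => x / 2 ^ (i * Nat.size y) / 2 ^ Nat.size y)
      (msp.app ih snd) fun x y => ?_
    rw [Nat.div_div_eq_div_mul, ← pow_add, Nat.succ_mul]

end IsPV₂

/-! ### Functions of the low `w` bits; definition by cases on a small argument -/

namespace IsPVDefinable

variable {n : ℕ}

/-- **Any function of the low `w` bits of a definable quantity is definable** (a decision tree on
`w` parities; finite functions are given by `cond`-cascades). [cite: Cook1975, §2] -/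
theorem lowBits (w : ℕ) : ∀ (g : ℕ → ℕ) {s : (Fin n → ℕ) → ℕ}, IsPVDefinable s →
    IsPVDefinable fun v => g (s v % 2 ^ w) := by
  induction w with
  | zero => intro g s _; exact (const (g 0)).congr fun v => by simp [Nat.mod_one]
  | succ w ih =>
    intro g s hs
    have h0 := ih g hs
    have h1 := ih (fun m => g (m + 2 ^ w)) hs
    have ht : IsPVDefinable fun v => s v / 2 ^ w % 2 :=
      IsPV₁.mod_two.app ((IsPV₁.div_two_pow w).app hs)
    refine (cond ht h0 h1).congr fun v => ?_
    rw [Nat.mod_pow_succ]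
    rcases Nat.mod_two_eq_zero_or_one (s v / 2 ^ w) with h | h <;> simp [h]

/-- **Definition by cases on the value of a definable selector below a fixed bound**: if `B i` is
definable for every `i < m` and `D` is definable, so is
`v ↦ if s v < m then B (s v) v else D v` (a cascade of `cond`s on `s`, `s ∸ 1`, …).
[cite: Cobham1965] -/
theorem cases (m : ℕ) : ∀ {s : (Fin n → ℕ) → ℕ} {B : ℕ → (Fin n → ℕ) → ℕ} {D : (Fin n → ℕ) → ℕ},
    IsPVDefinable s → (∀ i < m, IsPVDefinable (B i)) → IsPVDefinable D →
      IsPVDefinable fun v => if s v < m then B (s v) v else D v := by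
  induction m with
  | zero => intro s B D _ _ hD; exact hD.congr fun v => by simp
  | succ m ih =>
    intro s B D hs hB hD
    have hrec := ih (s := fun v => s v - 1) (B := fun i => B (i + 1)) (D := D) hs.pred
      (fun i hi => hB (i + 1) (by omega)) hD
    refine (cond hs (hB 0 (by omega)) hrec).congr fun v => ?_
    rcases Nat.eq_zero_or_pos (s v) with h | h
    · simp [h]
    · obtain ⟨j, hj⟩ : ∃ j, s v = j + 1 := ⟨s v - 1, by omega⟩
      simp only [hj, Nat.add_sub_cancel, Nat.add_lt_add_iff_right, Nat.succ_ne_zero, if_false]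

end IsPVDefinable

/-! ### Base-`2^w` digit stacks -/

namespace IsPV₁

/-- Appending a digit `d < 2^w` below: `r ↦ r · 2^w + d` is `s_{d₀} ∘ ⋯ ∘ s_{d_{w-1}}`.
[cite: Cook1975, §2] -/
theorem mul_two_pow_add (w : ℕ) : ∀ {d : ℕ}, d < 2 ^ w → IsPV₁ fun r => r * 2 ^ w + d := by
  induction w with
  | zero => intro d hd; exact IsPV₁.id.congr fun r => by simp at hd; simp [hd]
  | succ w ih =>
    intro d hd
    have h2 : d / 2 < 2 ^ w := by rw [pow_succ] at hd; omega
    refine IsPVDefinable.congr (IsPVDefinable.bit (Nat.bodd d) (ih h2)) fun v => ?_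
    show Nat.bit (Nat.bodd d) (v 0 * 2 ^ w + d / 2) = v 0 * 2 ^ (w + 1) + d
    have hd' : (Nat.bodd d).toNat + 2 * (d / 2) = d := by
      rw [← Nat.div2_val]; exact Nat.bodd_add_div2 d
    rw [Nat.bit_val, pow_succ, ← mul_assoc]
    omega

end IsPV₁

/-! ## Part II. Arithmetisation of flat programs

### Stacks of symbol numbers as base-`2^w` numerals -/

namespace FlatSim

open FlatProg (Instr Prog Cfg step)

/-- The code of a stack of symbol numbers (top first): sentinel digit `1` for the empty stack,
symbol `a` as the digit `a + 2`, in base `2^w`, top digit lowest. [cite: CookNguyen2010, Exercise VI.2.9] -/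
def stkNum (w : ℕ) : List ℕ → ℕ
  | [] => 1
  | a :: l => stkNum w l * 2 ^ w + (a + 2)

variable {w : ℕ}

/-- The empty stack is coded by `1`. [folklore] -/
@[simp] theorem stkNum_nil : stkNum w [] = 1 := rfl

/-- Pushing a symbol appends its digit. [folklore] -/
@[simp] theorem stkNum_cons (a : ℕ) (l : List ℕ) :
    stkNum w (a :: l) = stkNum w l * 2 ^ w + (a + 2) := rfl

/-- Stack codes are positive. [folklore] -/
theorem stkNum_pos (l : List ℕ) : 0 < stkNum w l := by
  cases l <;> simp

/-- The emptiness test: `⌊code / 2⌋ = 0` iff the stack is empty. [folklore] -/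
theorem stkNum_div_two_eq_zero_iff (l : List ℕ) : stkNum w l / 2 = 0 ↔ l = [] := by
  cases l with
  | nil => simp
  | cons a l =>
    simp only [stkNum_cons, reduceCtorEq, iff_false]
    have := stkNum_pos (w := w) l
    have : 1 ≤ stkNum w l * 2 ^ w := Nat.one_le_iff_ne_zero.2 (Nat.mul_ne_zero (by omega) (by positivity))
    omega

/-- The top digit. [folklore] -/
theorem stkNum_cons_mod {a : ℕ} (ha : a + 2 < 2 ^ w) (l : List ℕ) :
    stkNum w (a :: l) % 2 ^ w = a + 2 := by
  rw [stkNum_cons, Nat.mul_add_mod_of_lt ha]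

/-- Popping the top digit. [folklore] -/
theorem stkNum_cons_div {a : ℕ} (ha : a + 2 < 2 ^ w) (l : List ℕ) :
    stkNum w (a :: l) / 2 ^ w = stkNum w l := by
  rw [stkNum_cons, mul_comm, Nat.mul_add_div (by positivity), Nat.div_eq_of_lt ha, Nat.add_zero]

/-- Size of a stack code: `< 2^{w |l| + 1}`. [folklore] -/
theorem stkNum_lt {l : List ℕ} (hl : ∀ a ∈ l, a + 2 < 2 ^ w) :
    stkNum w l < 2 ^ (w * l.length + 1) := by
  induction l with
  | nil => simp
  | cons a l ih =>
    have ha := hl a (by simp)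
    have ih' := ih fun b hb => hl b (by simp [hb])
    rw [stkNum_cons, List.length_cons, Nat.mul_succ, show w * l.length + w + 1 = (w * l.length + 1) + w by omega,
      pow_add]
    have h1 : stkNum w l * 2 ^ w + (a + 2) < (stkNum w l + 1) * 2 ^ w := by rw [Nat.add_mul, one_mul]; omega
    exact h1.trans_le (Nat.mul_le_mul_right _ ih')

/-- The digits of a stack code: digit `j < |l|` is `l[j] + 2`. [folklore] -/
theorem stkNum_div_pow_mod {l : List ℕ} (hl : ∀ a ∈ l, a + 2 < 2 ^ w) {j : ℕ} (hj : j < l.length) :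
    stkNum w l / 2 ^ (w * j) % 2 ^ w = l[j] + 2 := by
  induction l generalizing j with
  | nil => simp at hj
  | cons a l ih =>
    have ha := hl a (by simp)
    cases j with
    | zero => simpa using stkNum_cons_mod ha l
    | succ j =>
      rw [Nat.mul_succ, pow_add, mul_comm (2 ^ (w * j)), ← Nat.div_div_eq_div_mul, stkNum_cons_div ha,
        List.getElem_cons_succ]
      exact ih (fun b hb => hl b (by simp [hb])) (by simpa using hj)

/-- The sentinel digit: digit `|l|` is `1`. [folklore] -/
theorem stkNum_div_pow_length {l : List ℕ} (hl : ∀ a ∈ l, a + 2 < 2 ^ w) :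
    stkNum w l / 2 ^ (w * l.length) = 1 := by
  induction l with
  | nil => simp
  | cons a l ih =>
    have ha := hl a (by simp)
    rw [List.length_cons, Nat.mul_succ, pow_add, mul_comm (2 ^ (w * l.length)), ← Nat.div_div_eq_div_mul,
      stkNum_cons_div ha]
    exact ih fun b hb => hl b (by simp [hb])

/-- Beyond the sentinel all digits vanish. [folklore] -/
theorem stkNum_div_pow_of_lt {l : List ℕ} (hl : ∀ a ∈ l, a + 2 < 2 ^ w) {j : ℕ} (hj : l.length < j)
    (hw : 1 ≤ w) : stkNum w l / 2 ^ (w * j) = 0 := by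
  apply Nat.div_eq_of_lt
  refine (stkNum_lt hl).trans_le (Nat.pow_le_pow_right (by norm_num) ?_)
  calc w * l.length + 1 ≤ w * l.length + w := by omega
    _ = w * (l.length + 1) := by ring
    _ ≤ w * j := Nat.mul_le_mul_left _ hj

/-! ### Numeric configurations and the numeric step -/

/-- The numeric form of an untyped configuration: component `0` is the program counter,
component `i + 1` the code of stack `i` (missing stacks read as empty). [cite: CookNguyen2010, Exercise VI.2.9] -/
def cfgNum (w : ℕ) (c : Cfg) : ℕ → ℕ := fun i => if i = 0 then c.1 else stkNum w (c.2.getD (i - 1) [])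

/-- Jump target of a `pop`: table entry `0` on an empty stack, entry `top + 1` otherwise (read
off the top digit `top + 2`). [folklore] -/
def popTarget (w : ℕ) (t : List ℕ) (r : ℕ) : ℕ :=
  if r / 2 = 0 then t.getD 0 0 else t.getD (r % 2 ^ w - 1) 0

/-- Stack code after a `pop` (unchanged when empty). [folklore] -/
def popVal (w : ℕ) (r : ℕ) : ℕ := if r / 2 = 0 then r else r / 2 ^ w

/-- One instruction on numeric configurations with `nK` stacks. [cite: CookNguyen2010, Exercise VI.2.9] -/
def applyNum (w nK : ℕ) : Instr → (ℕ → ℕ) → ℕ → ℕ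
  | .goto j, c, i => if i = 0 then j else c i
  | .push k a j, c, i => if i = 0 then j else if i = k + 1 ∧ k < nK then c i * 2 ^ w + (a + 2) else c i
  | .pop k t, c, i =>
      if i = 0 then (if k < nK then popTarget w t (c (k + 1)) else t.getD 0 0)
      else if i = k + 1 ∧ k < nK then popVal w (c i) else c i

/-- **The numeric step** (`Next_M`): dispatch on the program counter; identity when halted.
[cite: CookNguyen2010, Exercise VI.2.9] -/
def stepNum (w nK : ℕ) (P : Prog) (c : ℕ → ℕ) (i : ℕ) : ℕ :=
  if c 0 < P.length then applyNum w nK (P.getD (c 0) (.goto 0)) c i else c i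

/-- `getD` after `modify` by a cons. [folklore] -/
theorem getD_modify_cons (S : List (List ℕ)) (k a i : ℕ) :
    (S.modify k (fun l => a :: l)).getD i [] = if k = i ∧ k < S.length then a :: S.getD i [] else S.getD i [] := by
  rw [List.getD_eq_getElem?_getD, List.getElem?_modify, List.getD_eq_getElem?_getD]
  by_cases h : k = i
  · subst h
    by_cases hk : k < S.length <;> simp [hk]
  · simp [h]

/-- `getD` after `set`. [folklore] -/
theorem getD_set (S : List (List ℕ)) (k i : ℕ) (L : List ℕ) :
    (S.set k L).getD i [] = if k = i ∧ k < S.length then L else S.getD i [] := by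
  rw [List.getD_eq_getElem?_getD, List.getElem?_set, List.getD_eq_getElem?_getD]
  by_cases h : k = i
  · subst h
    by_cases hk : k < S.length <;> simp [hk]
  · simp [h]

/-- **One numeric step simulates one flat step** on configurations with `nK` stacks whose
symbols are small. [cite: CookNguyen2010, Exercise VI.2.9] -/
theorem stepNum_cfgNum (P : Prog) {nK : ℕ} {cfg : Cfg} (hlen : cfg.2.length = nK)
    (hsym : ∀ i, ∀ a ∈ cfg.2.getD i [], a + 2 < 2 ^ w) (i : ℕ) :
    stepNum w nK P (cfgNum w cfg) i = cfgNum w (step P cfg) i := by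
  obtain ⟨pc, S⟩ := cfg
  simp only at hlen hsym
  have hc0 : cfgNum w (pc, S) 0 = pc := by simp [cfgNum]
  unfold stepNum
  rw [hc0]
  by_cases hpc : pc < P.length
  swap
  · rw [if_neg hpc, FlatProg.step_of_le (not_lt.1 hpc)]
  rw [if_pos hpc]
  have hget : P[pc]? = some P[pc] := List.getElem?_eq_getElem hpc
  rw [FlatProg.step_of_getElem? hget, List.getD_eq_getElem?_getD, hget, Option.getD_some]
  cases P[pc] with
  | goto j =>
    show (if i = 0 then j else cfgNum w (pc, S) i) = cfgNum w (j, S) i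
    unfold cfgNum
    by_cases hi : i = 0 <;> simp [hi]
  | push k a j =>
    show (if i = 0 then j else if i = k + 1 ∧ k < nK then cfgNum w (pc, S) i * 2 ^ w + (a + 2)
      else cfgNum w (pc, S) i) = cfgNum w (j, S.modify k (fun l => a :: l)) i
    unfold cfgNum
    by_cases hi : i = 0
    · simp [hi]
    simp only [if_neg hi]
    rw [getD_modify_cons, hlen]
    by_cases hk : i = k + 1 ∧ k < nK
    · obtain ⟨rfl, hk'⟩ := hk
      simp [hk']
    · rw [if_neg hk, if_neg (fun h => hk ⟨by omega, h.2⟩)]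
  | pop k t =>
    show (if i = 0 then (if k < nK then popTarget w t (cfgNum w (pc, S) (k + 1)) else t.getD 0 0)
      else if i = k + 1 ∧ k < nK then popVal w (cfgNum w (pc, S) i) else cfgNum w (pc, S) i) =
      cfgNum w (t.getD (FlatProg.tblIdx (S.getD k []).head?) 0, S.set k (S.getD k []).tail) i
    unfold cfgNum
    by_cases hi : i = 0
    · subst hi
      simp only [if_true, Nat.succ_ne_zero, if_false, Nat.add_sub_cancel]
      by_cases hk : k < nK
      · rw [if_pos hk]
        unfold popTarget
        cases hS : S.getD k [] with
        | nil => simp [FlatProg.tblIdx]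
        | cons a l =>
          have ha : a + 2 < 2 ^ w := hsym k a (by rw [hS]; simp)
          rw [if_neg ((stkNum_div_two_eq_zero_iff (a :: l)).not.2 (List.cons_ne_nil a l)),
            stkNum_cons_mod ha]
          rfl
      · rw [if_neg hk]
        have : S.getD k [] = [] := by
          rw [List.getD_eq_getElem?_getD, List.getElem?_eq_none (by omega)]; rfl
        rw [this]; rfl
    · simp only [if_neg hi]
      rw [getD_set, hlen]
      by_cases hk : i = k + 1 ∧ k < nK
      · obtain ⟨rfl, hk'⟩ := hk
        simp only [hk', and_true, if_true, Nat.add_sub_cancel]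
        unfold popVal
        cases hS : S.getD k [] with
        | nil => simp
        | cons a l =>
          have ha : a + 2 < 2 ^ w := hsym k a (by rw [hS]; simp)
          rw [if_neg ((stkNum_div_two_eq_zero_iff (a :: l)).not.2 (List.cons_ne_nil a l)),
            stkNum_cons_div ha]
          rfl
      · rw [if_neg hk, if_neg (fun h => hk ⟨by omega, h.2⟩)]

/-! ### Invariants of flat runs: symbols, number of stacks, program counter, stack heights -/

/-- The digit of a `push` instruction (`0` for the others). [folklore] -/
def pushDigit : Instr → ℕ
  | .push _ a _ => a + 2
  | _ => 0

/-- The largest jump target of an instruction. [folklore] -/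
def maxTarget : Instr → ℕ
  | .goto j => j
  | .push _ _ j => j
  | .pop _ t => t.foldr max 0

/-- A bound on all jump targets of a program. [folklore] -/
def pcBound (P : Prog) : ℕ := P.foldr (fun ins m => max (maxTarget ins) m) 0

/-- A bound on all `push` digits of a program. [folklore] -/
def maxPush (P : Prog) : ℕ := P.foldr (fun ins m => max (pushDigit ins) m) 0

/-- All symbols on all stacks have digits `< 2^w`. [folklore] -/
def SymOK (w : ℕ) (S : List (List ℕ)) : Prop := ∀ i, ∀ a ∈ S.getD i [], a + 2 < 2 ^ w

/-- Table entries are bounded by the fold of `max`. [folklore] -/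
theorem getD_le_foldr_max (t : List ℕ) (i : ℕ) : t.getD i 0 ≤ t.foldr max 0 := by
  induction t generalizing i with
  | nil => simp
  | cons a t ih =>
    cases i with
    | zero => simp
    | succ i => simp only [List.getD_cons_succ, List.foldr_cons]; exact (ih i).trans (le_max_right _ _)

/-- Targets of an instruction of the program are below `pcBound`. [folklore] -/
theorem maxTarget_le_pcBound {P : Prog} {ins : Instr} (h : ins ∈ P) : maxTarget ins ≤ pcBound P := by
  induction P with
  | nil => simp at h
  | cons a P ih =>
    simp only [pcBound, List.foldr_cons]
    rcases List.mem_cons.1 h with rfl | h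
    · exact le_max_left _ _
    · exact (ih h).trans (le_max_right _ _)

/-- Push digits of an instruction of the program are below `maxPush`. [folklore] -/
theorem pushDigit_le_maxPush {P : Prog} {ins : Instr} (h : ins ∈ P) : pushDigit ins ≤ maxPush P := by
  induction P with
  | nil => simp at h
  | cons a P ih =>
    simp only [maxPush, List.foldr_cons]
    rcases List.mem_cons.1 h with rfl | h
    · exact le_max_left _ _
    · exact (ih h).trans (le_max_right _ _)

/-- The new program counter of any numeric step is an old one or a program target. [folklore] -/
theorem stepNum_zero_le (w nK : ℕ) (P : Prog) (c : ℕ → ℕ) :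
    stepNum w nK P c 0 ≤ max (c 0) (pcBound P) := by
  unfold stepNum
  by_cases hpc : c 0 < P.length
  swap
  · rw [if_neg hpc]; exact le_max_left _ _
  rw [if_pos hpc]
  have hmem : P.getD (c 0) (.goto 0) ∈ P := by
    rw [List.getD_eq_getElem?_getD, List.getElem?_eq_getElem hpc]; exact List.getElem_mem hpc
  refine le_trans ?_ ((maxTarget_le_pcBound hmem).trans (le_max_right _ _))
  cases P.getD (c 0) (.goto 0) with
  | goto j => simp [applyNum, maxTarget]
  | push k a j => simp [applyNum, maxTarget]
  | pop k t =>
    simp only [applyNum, if_true, maxTarget]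
    by_cases hk : k < nK
    · rw [if_pos hk]; unfold popTarget; split <;> exact getD_le_foldr_max _ _
    · rw [if_neg hk]; exact getD_le_foldr_max _ _

/-- The new stack codes of any numeric step grow by at most one digit. [folklore] -/
theorem stepNum_succ_lt {w nK : ℕ} {P : Prog} (hP : maxPush P < 2 ^ w) (c : ℕ → ℕ) (i : ℕ) :
    stepNum w nK P c (i + 1) < (c (i + 1) + 1) * 2 ^ w := by
  have hw : 1 ≤ 2 ^ w := Nat.one_le_two_pow
  have hle : c (i + 1) < (c (i + 1) + 1) * 2 ^ w := by
    calc c (i + 1) < c (i + 1) + 1 := Nat.lt_succ_self _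
      _ ≤ (c (i + 1) + 1) * 2 ^ w := Nat.le_mul_of_pos_right _ (by omega)
  unfold stepNum
  by_cases hpc : c 0 < P.length
  swap
  · rw [if_neg hpc]; exact hle
  rw [if_pos hpc]
  have hmem : P.getD (c 0) (.goto 0) ∈ P := by
    rw [List.getD_eq_getElem?_getD, List.getElem?_eq_getElem hpc]; exact List.getElem_mem hpc
  have hdig := (pushDigit_le_maxPush hmem).trans_lt hP
  revert hdig
  cases P.getD (c 0) (.goto 0) with
  | goto j => intro; simpa [applyNum] using hle
  | push k a j =>
    intro hdig
    simp only [applyNum, Nat.succ_ne_zero, if_false, pushDigit] at hdig ⊢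
    split
    · rw [Nat.add_mul, one_mul]; omega
    · exact hle
  | pop k t =>
    intro
    simp only [applyNum, Nat.succ_ne_zero, if_false]
    split
    · unfold popVal; split
      · exact hle
      · exact (Nat.div_le_self _ _).trans_lt hle
    · exact hle

/-- One flat step keeps the number of stacks. [folklore] -/
private theorem length_step (P : Prog) (cfg : Cfg) : (step P cfg).2.length = cfg.2.length := by
  unfold step
  cases P[cfg.1]? with
  | none => rfl
  | some ins => cases ins <;> simp [Instr.apply]

/-- One flat step keeps the symbol invariant when the program's digits are `< 2^w`. [folklore] -/
theorem symOK_step {P : Prog} (hP : maxPush P < 2 ^ w) {cfg : Cfg} (h : SymOK w cfg.2) :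
    SymOK w (step P cfg).2 := by
  unfold step
  cases hget : P[cfg.1]? with
  | none => exact h
  | some ins =>
    have hmem : ins ∈ P := List.mem_of_getElem? hget
    have hdig := (pushDigit_le_maxPush hmem).trans_lt hP
    cases ins with
    | goto j => exact h
    | push k a j =>
      intro i b hb
      simp only [Instr.apply] at hb
      rw [getD_modify_cons] at hb
      split at hb
      · rcases List.mem_cons.1 hb with rfl | hb
        · exact hdig
        · exact h i b hb
      · exact h i b hb
    | pop k t =>
      intro i b hb
      simp only [Instr.apply] at hb
      rw [getD_set] at hb
      split at hb
      · exact h k b (List.mem_of_mem_tail hb)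
      · exact h i b hb

/-- One flat step moves the program counter to an old value or a target. [folklore] -/
theorem fst_step_le (P : Prog) (cfg : Cfg) : (step P cfg).1 ≤ max cfg.1 (pcBound P) := by
  unfold step
  cases hget : P[cfg.1]? with
  | none => exact le_max_left _ _
  | some ins =>
    have hmem : ins ∈ P := List.mem_of_getElem? hget
    refine le_trans ?_ ((maxTarget_le_pcBound hmem).trans (le_max_right _ _))
    cases ins with
    | goto j => simp [Instr.apply, maxTarget]
    | push k a j => simp [Instr.apply, maxTarget]
    | pop k t => exact getD_le_foldr_max _ _

/-- **The invariants along a flat run.** [folklore] -/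
theorem invariants_iterate {P : Prog} (hP : maxPush P < 2 ^ w) (cfg : Cfg) (h : SymOK w cfg.2) (m : ℕ) :
    ((step P)^[m] cfg).2.length = cfg.2.length ∧ SymOK w ((step P)^[m] cfg).2 ∧
      ((step P)^[m] cfg).1 ≤ max cfg.1 (pcBound P) := by
  induction m with
  | zero => exact ⟨rfl, h, le_max_left _ _⟩
  | succ m ih =>
    obtain ⟨h1, h2, h3⟩ := ih
    rw [Function.iterate_succ_apply']
    refine ⟨(length_step _ _).trans h1, symOK_step hP h2, (fst_step_le _ _).trans ?_⟩
    exact max_le h3 (le_max_right _ _)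

/-- Every stack is at most as long as the total. [folklore] -/
theorem length_getD_le_stkTotal (S : List (List ℕ)) (i : ℕ) : (S.getD i []).length ≤ FlatProg.stkTotal S := by
  induction S generalizing i with
  | nil => simp
  | cons l S ih =>
    cases i with
    | zero => simp [FlatProg.stkTotal]
    | succ i =>
      simp only [List.getD_cons_succ]
      refine (ih i).trans ?_
      simp [FlatProg.stkTotal]

/-! ### Packing a tuple in base `2^L` -/

/-- `pack L m c = Σ_{i<m} c i · 2^{iL}` (Horner form). [cite: CookNguyen2010, §V.4 (Row)] -/
def pack (L : ℕ) : ℕ → (ℕ → ℕ) → ℕ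
  | 0, _ => 0
  | m + 1, c => c 0 + 2 ^ L * pack L m (fun i => c (i + 1))

/-- `pack` depends only on the first `m` components. [folklore] -/
theorem pack_congr {L : ℕ} : ∀ {m : ℕ} {c c' : ℕ → ℕ}, (∀ i < m, c i = c' i) → pack L m c = pack L m c'
  | 0, _, _, _ => rfl
  | m + 1, c, c', h => by
    simp only [pack]
    rw [h 0 (by omega), pack_congr (m := m) (fun i hi => h (i + 1) (by omega))]

/-- **Unpacking**: component `i` is `⌊pack / 2^{iL}⌋ mod 2^L`. [folklore] -/
theorem pack_div_mod {L : ℕ} : ∀ {m : ℕ} {c : ℕ → ℕ}, (∀ i < m, c i < 2 ^ L) →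
    ∀ i < m, pack L m c / 2 ^ (i * L) % 2 ^ L = c i
  | 0, _, _, i, hi => absurd hi (Nat.not_lt_zero _)
  | m + 1, c, hc, 0, _ => by
    simp only [pack, Nat.zero_mul, pow_zero, Nat.div_one]
    rw [Nat.add_mul_mod_self_left, Nat.mod_eq_of_lt (hc 0 (by omega))]
  | m + 1, c, hc, i + 1, hi => by
    simp only [pack]
    rw [Nat.succ_mul, Nat.add_comm (i * L), pow_add, ← Nat.div_div_eq_div_mul,
      Nat.add_mul_div_left _ _ (by positivity), Nat.div_eq_of_lt (hc 0 (by omega)), Nat.zero_add]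
    exact pack_div_mod (fun j hj => hc (j + 1) (by omega)) i (by omega)

/-- **Size of a packed tuple.** [folklore] -/
theorem pack_lt {L E : ℕ} : ∀ {m : ℕ} {c : ℕ → ℕ}, (∀ i < m, c i < 2 ^ (L + E)) →
    pack L m c < 2 ^ (m * L + E + m)
  | 0, _, _ => by simp [pack]
  | m + 1, c, hc => by
    simp only [pack]
    have h0 := hc 0 (by omega)
    have ih := pack_lt (m := m) (c := fun i => c (i + 1)) (fun i hi => hc (i + 1) (by omega))
    have hE : 2 ^ E ≤ 2 ^ (m * L + E + m) := Nat.pow_le_pow_right (by norm_num) (by omega)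
    calc c 0 + 2 ^ L * pack L m (fun i => c (i + 1))
        < 2 ^ (L + E) + 2 ^ L * 2 ^ (m * L + E + m) := by
          have := Nat.mul_le_mul_left (2 ^ L) ih.le
          have h2 : 0 < 2 ^ L := by positivity
          nlinarith
      _ ≤ 2 ^ L * 2 ^ (m * L + E + m) + 2 ^ L * 2 ^ (m * L + E + m) := by
          rw [pow_add]; exact Nat.add_le_add_right (Nat.mul_le_mul_left _ hE) _
      _ = 2 ^ ((m + 1) * L + E + (m + 1)) := by
          rw [← two_mul, ← pow_add, ← pow_succ']; congr 1; ring

/-! ### `PV`-definability of the numeric step, packing and unpacking -/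

section PV

variable {n : ℕ}

/-- `popTarget` is definable (a function of the low `w` bits, guarded by the emptiness test).
[cite: CookNguyen2010, Exercise VI.2.9] -/
theorem isPVDefinable_popTarget (w : ℕ) (t : List ℕ) {U : (Fin n → ℕ) → ℕ} (hU : IsPVDefinable U) :
    IsPVDefinable fun v => popTarget w t (U v) :=
  IsPVDefinable.cond hU.half (IsPVDefinable.const _) (IsPVDefinable.lowBits w (fun m => t.getD (m - 1) 0) hU)

/-- `popVal` is definable. [cite: CookNguyen2010, Exercise VI.2.9] -/
theorem isPVDefinable_popVal (w : ℕ) {U : (Fin n → ℕ) → ℕ} (hU : IsPVDefinable U) :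
    IsPVDefinable fun v => popVal w (U v) :=
  IsPVDefinable.cond hU.half hU ((IsPV₁.div_two_pow w).app hU)

/-- One instruction is definable, component by component. [cite: CookNguyen2010, Exercise VI.2.9] -/
theorem isPVDefinable_applyNum (w nK : ℕ) (ins : Instr) (i : ℕ) {U : ℕ → (Fin n → ℕ) → ℕ}
    (hU : ∀ j, IsPVDefinable (U j)) : IsPVDefinable fun v => applyNum w nK ins (fun j => U j v) i := by
  cases ins with
  | goto j =>
    by_cases hi : i = 0
    · simp only [applyNum, hi, if_true]; exact IsPVDefinable.const j
    · simp only [applyNum, hi, if_false]; exact hU i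
  | push k a j =>
    by_cases hi : i = 0
    · simp only [applyNum, hi, if_true]; exact IsPVDefinable.const j
    · simp only [applyNum, hi, if_false]
      by_cases hk : i = k + 1 ∧ k < nK
      · simp only [hk, and_self, if_true]
        exact ((hU _).mul (IsPVDefinable.const _)).add (IsPVDefinable.const _)
      · simp only [hk, if_false]; exact hU i
  | pop k t =>
    by_cases hi : i = 0
    · simp only [applyNum, hi, if_true]
      by_cases hk : k < nK
      · simp only [hk, if_true]; exact isPVDefinable_popTarget w t (hU _)
      · simp only [hk, if_false]; exact IsPVDefinable.const _
    · simp only [applyNum, hi, if_false]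
      by_cases hk : i = k + 1 ∧ k < nK
      · simp only [hk, and_self, if_true]; exact isPVDefinable_popVal w (hU _)
      · simp only [hk, if_false]; exact hU i

/-- **`Next_M` is definable**, component by component (definition by cases on the program
counter). [cite: CookNguyen2010, Exercise VI.2.9] -/
theorem isPVDefinable_stepNum (w nK : ℕ) (P : Prog) (i : ℕ) {U : ℕ → (Fin n → ℕ) → ℕ}
    (hU : ∀ j, IsPVDefinable (U j)) : IsPVDefinable fun v => stepNum w nK P (fun j => U j v) i :=
  IsPVDefinable.cases P.length (s := U 0)
    (B := fun pc v => applyNum w nK (P.getD pc (.goto 0)) (fun j => U j v) i) (D := U i) (hU 0)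
    (fun _ _ => isPVDefinable_applyNum w nK _ i hU) (hU i)

/-- **Packing is definable** when the base is `2^{|B|}` for a definable `B`. [cite: CookNguyen2010, §V.4 (Row)] -/
theorem isPVDefinable_pack {B : (Fin n → ℕ) → ℕ} (hB : IsPVDefinable B) :
    ∀ (m : ℕ) {C : ℕ → (Fin n → ℕ) → ℕ}, (∀ i < m, IsPVDefinable (C i)) →
      IsPVDefinable fun v => pack (Nat.size (B v)) m (fun i => C i v)
  | 0, _, _ => IsPVDefinable.const 0
  | m + 1, C, hC => by
    show IsPVDefinable fun v => C 0 v + 2 ^ Nat.size (B v) * pack (Nat.size (B v)) m (fun i => C (i + 1) v)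
    exact (hC 0 (by omega)).add ((IsPV₁.pow_size.app hB).mul
      (isPVDefinable_pack hB m (fun i hi => hC (i + 1) (by omega))))

/-- **Unpacking is definable**: `⌊u / 2^{i|B|}⌋ mod 2^{|B|}`. [cite: Cook1975, §2] -/
theorem isPVDefinable_unpack {B u : (Fin n → ℕ) → ℕ} (hB : IsPVDefinable B) (hu : IsPVDefinable u) (i : ℕ) :
    IsPVDefinable fun v => u v / 2 ^ (i * Nat.size (B v)) % 2 ^ Nat.size (B v) :=
  IsPV₂.lsp.app ((IsPV₂.msp_pow i).app hu hB) hB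

end PV

/-! ### Mathlib's binary numerals, one bit at a time -/

/-- `encodeNat (s_b n) = b :: encodeNat n` for `s_b n ≠ 0` (little-endian numerals). [folklore] -/
theorem encodeNat_bit (b : Bool) (n : ℕ) (h : Nat.bit b n ≠ 0) :
    encodeNat (Nat.bit b n) = b :: encodeNat n := by
  have h1 : bitsToNat (b :: encodeNat n) = Nat.bit b n := by
    rw [bitsToNat_cons, bitsToNat_encodeNat, Nat.bit_val]; omega
  rw [← h1, ← norm_eq_encodeNat, norm_cons, norm_encodeNat]
  by_cases hn : n = 0
  · subst hn
    have hb : b = true := by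
      cases b
      · exact absurd rfl h
      · rfl
    subst hb
    rfl
  · have : encodeNat n ≠ [] := fun he => hn (by
      have := (norm_eq_nil_iff (encodeNat n)).1 (by rw [norm_encodeNat, he]); simpa using this)
    rw [if_neg this]

/-! ### The data of a simulation, its digit width, clock and capacity -/

/-- The finite data of a flat simulation: the flat program, its number of stacks, the input and
output stacks, the initial program counter, the symbol numbers of the two input symbols, the
symbol number of the output symbol `true`, and the two parameters of the clock.
[cite: CookNguyen2010, Thm. VI.2.12 (proof sketch)] -/
structure FlatData where
  /-- the flat program -/
  P : Prog
  /-- number of stacks -/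
  nK : ℕ
  /-- input stack -/
  k₀ : ℕ
  /-- output stack -/
  k₁ : ℕ
  /-- initial program counter -/
  pc₀ : ℕ
  /-- symbol numbers of the input symbols -/
  cI : Bool → ℕ
  /-- symbol number of the output symbol `true` -/
  cT : ℕ
  /-- clock constant -/
  C : ℕ
  /-- clock degree -/
  d : ℕ

namespace FlatData

variable (D : FlatData)

/-- The digit width: all digits of the program and of the input symbols are `< 2^w`. [folklore] -/
def wd : ℕ := Nat.size (max (maxPush D.P) (max (D.cI false) (D.cI true) + 2))

/-- Program digits fit. [folklore] -/
theorem maxPush_lt : maxPush D.P < 2 ^ D.wd :=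
  (le_max_left _ _).trans_lt (Nat.lt_size_self _)

/-- Input digits fit. [folklore] -/
theorem cI_lt (b : Bool) : D.cI b + 2 < 2 ^ D.wd := by
  refine lt_of_le_of_lt ?_ ((le_max_right _ _).trans_lt (Nat.lt_size_self _))
  cases b
  · exact Nat.add_le_add_right (le_max_left _ _) _
  · exact Nat.add_le_add_right (le_max_right _ _) _

/-- The digit width is positive. [folklore] -/
theorem one_le_wd : 1 ≤ D.wd := by
  have : Nat.size 2 ≤ D.wd := Nat.size_le_size ((Nat.le_add_left 2 _).trans (le_max_right _ _))
  have h2 : Nat.size 2 = 2 := by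
    have := @Nat.size_pow 1; simpa using this
  omega

/-- A bound on every program counter of the run. [folklore] -/
def pcMax : ℕ := max D.pc₀ (pcBound D.P)

/-- The tower `big d x`, of length `≥ (|x| + 1)^{d+1}`, built from `s₁` and `#`. [cite: Cobham1965] -/
def big : ℕ → ℕ → ℕ
  | 0, x => Nat.bit true x
  | d + 1, x => 2 ^ (Nat.size (big d x) * Nat.size (Nat.bit true x))

/-- Length of `s₁ x`. [folklore] -/
theorem size_bit_true (x : ℕ) : Nat.size (Nat.bit true x) = Nat.size x + 1 :=
  Nat.size_bit (Nat.bit_ne_zero_iff.2 (by simp) )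

/-- Length of the tower. [folklore] -/
theorem le_size_big (x : ℕ) : ∀ d : ℕ, (Nat.size x + 1) ^ (d + 1) ≤ Nat.size (big d x)
  | 0 => by rw [big, size_bit_true, zero_add, pow_one]
  | d + 1 => by
    rw [big, Nat.size_pow, size_bit_true, pow_succ]
    exact (Nat.mul_le_mul_right _ (le_size_big x d)).trans (Nat.le_succ _)

/-- The tower is definable. [cite: Cobham1965] -/
theorem pv_big : ∀ d : ℕ, IsPV₁ (big d)
  | 0 => IsPV₁.bit true
  | d + 1 => IsPVDefinable.smash (pv_big d) (IsPV₁.bit true)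

/-- **The clock** `cap x = big_d x # 2^C`, of length `≥ (C+1)(|x|+1)^{d+1} + 1`. [cite: CookNguyen2010, Thm. VI.2.12 (proof sketch, the term t)] -/
def cap (x : ℕ) : ℕ := 2 ^ (Nat.size (big D.d x) * Nat.size (2 ^ D.C))

/-- Length of the clock. [folklore] -/
theorem size_cap (x : ℕ) : Nat.size (D.cap x) = Nat.size (big D.d x) * (D.C + 1) + 1 := by
  rw [cap, Nat.size_pow, Nat.size_pow]

/-- The clock dominates the polynomial `(C+1)(|x|+1)^{d+1}`. [folklore] -/
theorem le_size_cap (x : ℕ) : (D.C + 1) * (Nat.size x + 1) ^ (D.d + 1) + 1 ≤ Nat.size (D.cap x) := by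
  rw [size_cap, mul_comm]
  exact Nat.succ_le_succ (Nat.mul_le_mul_right _ (le_size_big x D.d))

/-- The clock is longer than the input. [folklore] -/
theorem size_succ_le_size_cap (x : ℕ) : Nat.size x + 1 ≤ Nat.size (D.cap x) := by
  refine le_trans ?_ ((Nat.le_succ _).trans (D.le_size_cap x))
  calc Nat.size x + 1 = 1 * (Nat.size x + 1) ^ 1 := by simp
    _ ≤ (D.C + 1) * (Nat.size x + 1) ^ (D.d + 1) :=
        Nat.mul_le_mul (by omega) (Nat.pow_le_pow_right (by omega) (by omega))

/-- The clock is definable. [cite: Cobham1965] -/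
theorem pv_cap : IsPV₁ D.cap := IsPVDefinable.smash (pv_big D.d) (IsPVDefinable.const _)

/-- The capacity exponent constant. [folklore] -/
def c₁ : ℕ := max (2 * D.wd) (Nat.size D.pcMax)

/-- **The packing base** `bnd x = cap x # 2^{c₁}`; components are packed in base `2^{|bnd x|}`. [cite: CookNguyen2010, Thm. VI.2.12 (proof sketch)] -/
def bnd (x : ℕ) : ℕ := 2 ^ (Nat.size (D.cap x) * Nat.size (2 ^ D.c₁))

/-- The block length `L x = |bnd x|`. [folklore] -/
def L (x : ℕ) : ℕ := Nat.size (D.bnd x)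

/-- The block length, computed. [folklore] -/
theorem L_eq (x : ℕ) : D.L x = Nat.size (D.cap x) * (D.c₁ + 1) + 1 := by
  rw [L, bnd, Nat.size_pow, Nat.size_pow]

/-- The packing base is definable. [cite: Cobham1965] -/
theorem pv_bnd : IsPV₁ D.bnd := IsPVDefinable.smash D.pv_cap (IsPVDefinable.const _)

/-- Program counters fit in a block. [folklore] -/
theorem pcMax_lt (x : ℕ) : D.pcMax < 2 ^ D.L x := by
  refine (Nat.lt_size_self _).trans_le (Nat.pow_le_pow_right (by norm_num) ?_)
  rw [L_eq]
  have h1 : 1 ≤ Nat.size (D.cap x) := le_trans (by omega) (D.size_succ_le_size_cap x)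
  have h2 : Nat.size D.pcMax ≤ D.c₁ := le_max_right _ _
  calc Nat.size D.pcMax ≤ D.c₁ + 1 := by omega
    _ = 1 * (D.c₁ + 1) := (one_mul _).symm
    _ ≤ Nat.size (D.cap x) * (D.c₁ + 1) + 1 := (Nat.mul_le_mul_right _ h1).trans (Nat.le_succ _)

/-- Stack codes of the run fit in a block: `w (|x| + |cap x|) + 1 ≤ L x`. [folklore] -/
theorem wcap_le (x : ℕ) : D.wd * (Nat.size x + Nat.size (D.cap x)) + 1 ≤ D.L x := by
  rw [L_eq]
  have h1 := D.size_succ_le_size_cap x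
  have h2 : 2 * D.wd ≤ D.c₁ := le_max_left _ _
  have h3 : D.wd * (Nat.size x + Nat.size (D.cap x)) ≤ D.wd * (2 * Nat.size (D.cap x)) :=
    Nat.mul_le_mul_left _ (by omega)
  have h4 : D.wd * (2 * Nat.size (D.cap x)) = Nat.size (D.cap x) * (2 * D.wd) := by ring
  have h5 : Nat.size (D.cap x) * (2 * D.wd) ≤ Nat.size (D.cap x) * (D.c₁ + 1) :=
    Nat.mul_le_mul_left _ (by omega)
  omega

/-- A block holds at least one bit. [folklore] -/
theorem one_le_L (x : ℕ) : 1 ≤ D.L x := by rw [L_eq]; omega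

/-! ### `Init_M`, `Next_M`, `Conf_M`, `Out_M` as number-theoretic functions -/

/-- The flat initial configuration on input `n`. [cite: CookNguyen2010, Exercise VI.2.9 (Init_M)] -/
def initC (n : ℕ) : Cfg := (D.pc₀, (List.replicate D.nK []).set D.k₀ ((encodeNat n).map D.cI))

/-- Unpacking component `i` in base `2^{L x}`. [folklore] -/
def unpk (x u : ℕ) (i : ℕ) : ℕ := u / 2 ^ (i * D.L x) % 2 ^ D.L x

/-- `Init_M`, packed. [cite: CookNguyen2010, Exercise VI.2.9 (Init_M)] -/
def pinit (n : ℕ) : ℕ := pack (D.L n) (D.nK + 1) (cfgNum D.wd (D.initC n))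

/-- `Next_M`, packed (capacity parameter `x`). [cite: CookNguyen2010, Exercise VI.2.9 (Next_M)] -/
def pstep (x u : ℕ) : ℕ := pack (D.L x) (D.nK + 1) (stepNum D.wd D.nK D.P (D.unpk x u))

/-- `Conf_M`: the packed configuration after `|z|` steps. [cite: CookNguyen2010, Thm. VI.2.12 (Conf_M)] -/
def run (x z : ℕ) : ℕ := (D.pstep x)^[Nat.size z] (D.pinit x)

/-- `Out_M`, inner sum: the numeral read off the first `|v|` digits of a stack code `r`
(digit `cT + 2` ↦ bit `1`, any other digit ↦ bit `0`). [cite: CookNguyen2010, Exercise VI.2.9 (Out_M)] -/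
def decodeAux (r v : ℕ) : ℕ :=
  ∑ j ∈ Finset.range (Nat.size v), (if r / 2 ^ (D.wd * j) % 2 ^ D.wd = D.cT + 2 then 1 else 0) * 2 ^ j

/-- **The simulated function**: `Out_M (Conf_M (cap n, n))`. [cite: CookNguyen2010, Thm. VI.2.12, eq. (100)] -/
def sim (n : ℕ) : ℕ :=
  D.decodeAux (D.unpk n (D.run n (D.cap n)) (D.k₁ + 1)) (D.unpk n (D.run n (D.cap n)) (D.k₁ + 1))

/-! ### Definability -/

/-- The code of the input stack, by limited recursion on notation on the input
(`s_b n ↦` push the digit of `b`). [cite: CookNguyen2010, Exercise VI.2.9 (Init_M)] -/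
theorem pv_inputStk : IsPV₁ fun n => stkNum D.wd ((encodeNat n).map D.cI) := by
  have hw := D.one_le_wd
  refine IsPV₁.of_limRec 1 (h := fun b _ r => r * 2 ^ D.wd + (D.cI b + 2))
    (k := fun n => Nat.bit false (2 ^ (Nat.size n * Nat.size (2 ^ (D.wd - 1)))))
    (fun b => ((IsPVDefinable.proj 1).mul (IsPVDefinable.const _)).add (IsPVDefinable.const _))
    (IsPVDefinable.bit false (IsPVDefinable.smash (IsPVDefinable.proj 0) (IsPVDefinable.const _)))
    rfl ?_ ?_
  · intro b y hby
    rw [encodeNat_bit b y hby, List.map_cons, stkNum_cons]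
  · intro y
    have hlt := stkNum_lt (w := D.wd) (l := (encodeNat y).map D.cI) (fun a ha => by
      obtain ⟨b, -, rfl⟩ := List.mem_map.1 ha; exact D.cI_lt b)
    rw [List.length_map, TM2Pass.length_encodeNat_eq_size] at hlt
    rw [Nat.size_pow, Nat.sub_add_cancel hw, Nat.bit_val, mul_comm (Nat.size y)]
    simp only [Bool.toNat_false, Nat.add_zero]
    rw [pow_succ, mul_comm] at hlt
    exact hlt.le

/-- The stacks of the initial configuration. [folklore] -/
theorem initC_getD (n i : ℕ) : (D.initC n).2.getD i [] =
    if D.k₀ = i ∧ D.k₀ < D.nK then (encodeNat n).map D.cI else [] := by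
  rw [initC, getD_set, List.length_replicate]
  split
  · rfl
  · rw [List.getD_eq_getElem?_getD, List.getElem?_replicate]
    split <;> rfl

/-- The components of `Init_M` are definable. [cite: CookNguyen2010, Exercise VI.2.9 (Init_M)] -/
theorem pv_cfgNum_initC (i : ℕ) : IsPV₁ fun n => cfgNum D.wd (D.initC n) i := by
  by_cases hi : i = 0
  · exact (IsPV₁.const D.pc₀).congr fun n => by simp [cfgNum, hi, initC]
  by_cases hk : D.k₀ = i - 1 ∧ D.k₀ < D.nK
  · exact D.pv_inputStk.congr fun n => by rw [cfgNum, if_neg hi, initC_getD, if_pos hk]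
  · exact (IsPV₁.const 1).congr fun n => by rw [cfgNum, if_neg hi, initC_getD, if_neg hk]; rfl

/-- `Init_M` is definable. [cite: CookNguyen2010, Exercise VI.2.9 (Init_M)] -/
theorem pv_pinit : IsPV₁ D.pinit :=
  isPVDefinable_pack (B := fun v : Fin 1 → ℕ => D.bnd (v 0)) (D.pv_bnd.app (IsPVDefinable.proj 0))
    (D.nK + 1) (C := fun i v => cfgNum D.wd (D.initC (v 0)) i)
    (fun i _ => (D.pv_cfgNum_initC i).app (IsPVDefinable.proj 0))

/-- `Next_M` is definable. [cite: CookNguyen2010, Exercise VI.2.9 (Next_M)] -/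
theorem pv_pstep : IsPV₂ D.pstep :=
  isPVDefinable_pack (B := fun v : Fin 2 → ℕ => D.bnd (v 0)) (D.pv_bnd.app (IsPVDefinable.proj 0))
    (D.nK + 1) (C := fun i v => stepNum D.wd D.nK D.P (D.unpk (v 0) (v 1)) i)
    (fun i _ => isPVDefinable_stepNum D.wd D.nK D.P i (U := fun j v => D.unpk (v 0) (v 1) j)
      (fun j => isPVDefinable_unpack (D.pv_bnd.app (IsPVDefinable.proj 0)) (IsPVDefinable.proj 1) j))

/-- The bound of the recursion defining `Conf_M`. [folklore] -/
def K (x : ℕ) : ℕ := 2 ^ (Nat.size (D.bnd x) * Nat.size (2 ^ D.nK)) * 2 ^ (D.wd + (D.nK + 1))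

/-- The bound, computed. [folklore] -/
theorem K_eq (x : ℕ) : D.K x = 2 ^ ((D.nK + 1) * D.L x + D.wd + (D.nK + 1)) := by
  have h : (D.nK + 1) * D.L x + D.wd + (D.nK + 1) =
      Nat.size (D.bnd x) * Nat.size (2 ^ D.nK) + (D.wd + (D.nK + 1)) := by
    rw [Nat.size_pow, L]; ring
  rw [h, pow_add]; rfl

/-- The bound is definable. [cite: Cobham1965] -/
theorem pv_K : IsPV₁ D.K := (IsPVDefinable.smash D.pv_bnd (IsPVDefinable.const _)).mul (IsPVDefinable.const _)

/-- Unpacked components are below the base. [folklore] -/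
theorem unpk_lt (x u i : ℕ) : D.unpk x u i < 2 ^ D.L x := Nat.mod_lt _ (by positivity)

/-- `Next_M` stays below the bound, whatever its argument. [folklore] -/
theorem pstep_lt (x u : ℕ) : D.pstep x u < D.K x := by
  rw [K_eq, pstep]
  refine pack_lt fun i hi => ?_
  cases i with
  | zero =>
    refine (stepNum_zero_le _ _ _ _).trans_lt (max_lt ?_ ?_)
    · exact (D.unpk_lt x u 0).trans_le (Nat.pow_le_pow_right (by norm_num) (by omega))
    · refine lt_of_le_of_lt (le_max_right D.pc₀ _) ((D.pcMax_lt x).trans_le ?_)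
      exact Nat.pow_le_pow_right (by norm_num) (by omega)
  | succ j =>
    refine (stepNum_succ_lt D.maxPush_lt _ _).trans_le ?_
    rw [pow_add]
    exact Nat.mul_le_mul_right _ (D.unpk_lt x u (j + 1))

/-- The components of the initial configuration are below the base. [folklore] -/
theorem cfgNum_initC_lt (n i : ℕ) : cfgNum D.wd (D.initC n) i < 2 ^ D.L n := by
  unfold cfgNum
  split
  · exact lt_of_le_of_lt (le_max_left _ (pcBound D.P)) (D.pcMax_lt n)
  · rw [initC_getD]
    split
    · have hlt := stkNum_lt (w := D.wd) (l := (encodeNat n).map D.cI) (fun a ha => by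
        obtain ⟨b, -, rfl⟩ := List.mem_map.1 ha; exact D.cI_lt b)
      rw [List.length_map, TM2Pass.length_encodeNat_eq_size] at hlt
      refine hlt.trans_le (Nat.pow_le_pow_right (by norm_num) ?_)
      have := D.wcap_le n
      have : D.wd * Nat.size n ≤ D.wd * (Nat.size n + Nat.size (D.cap n)) := Nat.mul_le_mul_left _ (by omega)
      omega
    · simpa using Nat.one_lt_two_pow (by have := D.one_le_L n; omega)

/-- `Init_M` stays below the bound. [folklore] -/
theorem pinit_lt (n : ℕ) : D.pinit n < D.K n := by
  rw [K_eq, pinit]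
  exact pack_lt fun i _ => (D.cfgNum_initC_lt n i).trans_le (Nat.pow_le_pow_right (by norm_num) (by omega))

/-- **`Conf_M` is definable**, by limited recursion on notation on the clock. [cite: CookNguyen2010, Thm. VI.2.12 (Conf_M)] -/
theorem pv_run : IsPV₂ D.run := by
  refine IsPV₂.of_limRec (g := D.pinit) (h := fun _ x _ r => D.pstep x r) (k := fun x _ => D.K x)
    D.pv_pinit (fun _ => D.pv_pstep.app (IsPVDefinable.proj 0) (IsPVDefinable.proj 2))
    (IsPV₂.of_fst D.pv_K) (fun x => by simp [run]) ?_ ?_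
  · intro x b y hby
    rw [run, run, Nat.size_bit hby, Function.iterate_succ_apply']
  · intro x y
    rw [run]
    cases Nat.size y with
    | zero => exact (D.pinit_lt x).le
    | succ m => rw [Function.iterate_succ_apply']; exact (D.pstep_lt x _).le

/-- A sum of distinct powers of two below `2^s` is below `2^s`. [folklore] -/
theorem sum_indicator_pow_lt (f : ℕ → Prop) [DecidablePred f] (s : ℕ) :
    ∑ j ∈ Finset.range s, (if f j then 1 else 0) * 2 ^ j < 2 ^ s := by
  induction s with
  | zero => simp
  | succ s ih =>
    rw [Finset.sum_range_succ, pow_succ]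
    have : (if f s then 1 else 0) * 2 ^ s ≤ 2 ^ s := by split <;> simp
    omega

/-- **`Out_M` is definable**, by limited recursion on notation on `v`. [cite: CookNguyen2010, Exercise VI.2.9 (Out_M)] -/
theorem pv_decodeAux : IsPV₂ D.decodeAux := by
  refine IsPV₂.of_limRec (g := fun _ => 0)
    (h := fun _ r y acc => acc + (if r / 2 ^ (D.wd * Nat.size y) % 2 ^ D.wd = D.cT + 2 then 1 else 0) * 2 ^ Nat.size y)
    (k := fun _ v => 2 ^ Nat.size v) (IsPV₁.const 0) (fun _ => ?_) (IsPV₂.of_snd IsPV₁.pow_size)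
    (fun r => by simp [decodeAux]) ?_ ?_
  · refine (IsPVDefinable.proj 2).add (IsPVDefinable.mul ?_ (IsPV₁.pow_size.app (IsPVDefinable.proj 1)))
    exact IsPVDefinable.lowBits D.wd (fun m => if m = D.cT + 2 then 1 else 0)
      ((IsPV₂.msp_pow D.wd).app (IsPVDefinable.proj 0) (IsPVDefinable.proj 1))
  · intro r b y hby
    rw [decodeAux, decodeAux, Nat.size_bit hby, Finset.sum_range_succ]
  · intro r v
    exact (sum_indicator_pow_lt _ _).le

/-- **The simulated function is definable.** [cite: CookNguyen2010, Thm. VI.2.12, eq. (100)] -/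
theorem pv_sim : IsPV₁ D.sim := by
  have hu : IsPVDefinable fun v : Fin 1 → ℕ => D.unpk (v 0) (D.run (v 0) (D.cap (v 0))) (D.k₁ + 1) :=
    isPVDefinable_unpack (D.pv_bnd.app (IsPVDefinable.proj 0))
      (D.pv_run.app (IsPVDefinable.proj 0) (D.pv_cap.app (IsPVDefinable.proj 0))) (D.k₁ + 1)
  exact D.pv_decodeAux.app hu hu

/-! ### Correctness of the simulation -/

/-- The initial configuration has `nK` stacks. [folklore] -/
theorem length_initC (n : ℕ) : (D.initC n).2.length = D.nK := by simp [initC]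

/-- The initial configuration satisfies the symbol invariant. [folklore] -/
theorem symOK_initC (n : ℕ) : SymOK D.wd (D.initC n).2 := by
  intro i a ha
  rw [initC_getD] at ha
  split at ha
  · obtain ⟨b, -, rfl⟩ := List.mem_map.1 ha; exact D.cI_lt b
  · simp at ha

/-- The initial configuration holds `|n|` symbols at most. [folklore] -/
theorem stkTotal_initC_le (n : ℕ) : FlatProg.stkTotal (D.initC n).2 ≤ Nat.size n := by
  have key : ∀ (m k : ℕ) (l : List ℕ), FlatProg.stkTotal ((List.replicate m ([] : List ℕ)).set k l) ≤ l.length := by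
    intro m
    induction m with
    | zero => intro k l; simp [FlatProg.stkTotal]
    | succ m ih =>
      intro k l
      cases k with
      | zero =>
        simp [List.replicate_succ, FlatProg.stkTotal]
      | succ k =>
        rw [List.replicate_succ, List.set_cons_succ]
        have := ih k l
        simp only [FlatProg.stkTotal, List.map_cons, List.sum_cons, List.length_nil, Nat.zero_add] at this ⊢
        exact this
  refine (key _ _ _).trans ?_
  rw [List.length_map, TM2Pass.length_encodeNat_eq_size]

/-- The configurations of the run and their component bounds. [folklore] -/
theorem run_invariant (n m : ℕ) (hm : m ≤ Nat.size (D.cap n)) :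
    ((step D.P)^[m] (D.initC n)).2.length = D.nK ∧ SymOK D.wd ((step D.P)^[m] (D.initC n)).2 ∧
      ∀ i, cfgNum D.wd ((step D.P)^[m] (D.initC n)) i < 2 ^ D.L n := by
  obtain ⟨h1, h2, h3⟩ := invariants_iterate D.maxPush_lt (D.initC n) (D.symOK_initC n) m
  refine ⟨h1.trans (D.length_initC n), h2, fun i => ?_⟩
  unfold cfgNum
  split
  · exact lt_of_le_of_lt h3 (D.pcMax_lt n)
  · set S := ((step D.P)^[m] (D.initC n)).2
    have hlt := stkNum_lt (w := D.wd) (l := S.getD (i - 1) []) (h2 (i - 1))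
    refine hlt.trans_le (Nat.pow_le_pow_right (by norm_num) ?_)
    have hlen : (S.getD (i - 1) []).length ≤ Nat.size n + m :=
      (length_getD_le_stkTotal S (i - 1)).trans
        ((FlatProg.stkTotal_iterate_le D.P (D.initC n) m).trans
          (Nat.add_le_add_right (D.stkTotal_initC_le n) _))
    have := D.wcap_le n
    have : D.wd * (S.getD (i - 1) []).length ≤ D.wd * (Nat.size n + Nat.size (D.cap n)) :=
      Nat.mul_le_mul_left _ (by omega)
    omega

/-- `stepNum` reads only the first `nK + 1` components. [folklore] -/
theorem stepNum_congr {w nK : ℕ} (P : Prog) {c c' : ℕ → ℕ} (h : ∀ j ≤ nK, c j = c' j) {i : ℕ}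
    (hi : i ≤ nK) : stepNum w nK P c i = stepNum w nK P c' i := by
  unfold stepNum
  rw [h 0 (Nat.zero_le _)]
  split
  swap
  · exact h i hi
  cases P.getD (c' 0) (.goto 0) with
  | goto j => simp [applyNum, h i hi]
  | push k a j => simp [applyNum, h i hi]
  | pop k t =>
    simp only [applyNum, h i hi]
    by_cases hk : k < nK
    · rw [h (k + 1) (by omega)]
    · simp [hk]

/-- **`Conf_M` is the packed configuration of the flat run**, as long as the clock lasts.
[cite: CookNguyen2010, Thm. VI.2.12 (Conf_M)] -/
theorem iterate_pstep_eq (n : ℕ) : ∀ m ≤ Nat.size (D.cap n),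
    (D.pstep n)^[m] (D.pinit n) = pack (D.L n) (D.nK + 1) (cfgNum D.wd ((step D.P)^[m] (D.initC n)))
  | 0, _ => rfl
  | m + 1, hm => by
    rw [Function.iterate_succ_apply', iterate_pstep_eq n m (by omega), Function.iterate_succ_apply']
    obtain ⟨h1, h2, h3⟩ := D.run_invariant n m (by omega)
    rw [pstep]
    apply pack_congr
    intro i hi
    have hunpk : ∀ j ≤ D.nK, D.unpk n (pack (D.L n) (D.nK + 1) (cfgNum D.wd ((step D.P)^[m] (D.initC n)))) j =
        cfgNum D.wd ((step D.P)^[m] (D.initC n)) j :=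
      fun j hj => pack_div_mod (fun i _ => h3 i) j (by omega)
    rw [stepNum_congr D.P hunpk (by omega), stepNum_cfgNum D.P h1 h2]

/-- The value of a little-endian bit string as a sum. [folklore] -/
theorem bitsToNat_eq_sum (y : List Bool) :
    bitsToNat y = ∑ j ∈ Finset.range y.length, (if y.getD j false = true then 1 else 0) * 2 ^ j := by
  induction y with
  | nil => simp
  | cons b y ih =>
    rw [bitsToNat_cons, List.length_cons, Finset.sum_range_succ', ih, Finset.mul_sum, add_comm]
    congr 1
    · refine Finset.sum_congr rfl fun j _ => ?_
      rw [List.getD_cons_succ, pow_succ]; ring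
    · cases b <;> simp

/-- Trailing zero summands do not change a sum over a range. [folklore] -/
theorem sum_range_eq_of_zero {f : ℕ → ℕ} {a : ℕ} (h : ∀ j, a ≤ j → f j = 0) {N : ℕ} (hN : a ≤ N) :
    ∑ j ∈ Finset.range N, f j = ∑ j ∈ Finset.range a, f j := by
  obtain ⟨d, rfl⟩ := Nat.exists_eq_add_of_le hN
  clear hN
  induction d with
  | zero => rfl
  | succ d ih => rw [← Nat.add_assoc, Finset.sum_range_succ, h _ (by omega), ih, Nat.add_zero]

/-- **`Out_M` reads the output numeral**: on the code of the stack `y.map cO` (digits faithful on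
`y`: `cO b = cT` only for `b = true`), `decodeAux` returns the value of `y`, provided at least
`|y|` digits are read. [cite: CookNguyen2010, Exercise VI.2.9 (Out_M)] -/
theorem decodeAux_stkNum {y : List Bool} {cO : Bool → ℕ} (hsym : ∀ b ∈ y, cO b + 2 < 2 ^ D.wd)
    (hfaith : ∀ b ∈ y, cO b = D.cT → b = true) (hT : cO true = D.cT) {v : ℕ} (hv : y.length ≤ Nat.size v) :
    D.decodeAux (stkNum D.wd (y.map cO)) v = bitsToNat y := by
  have hw := D.one_le_wd
  have hsym' : ∀ a ∈ y.map cO, a + 2 < 2 ^ D.wd := fun a ha => by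
    obtain ⟨b, hb, rfl⟩ := List.mem_map.1 ha; exact hsym b hb
  have h2w : 2 ≤ 2 ^ D.wd := by
    calc (2 : ℕ) = 2 ^ 1 := by norm_num
      _ ≤ 2 ^ D.wd := Nat.pow_le_pow_right (by norm_num) hw
  rw [decodeAux, bitsToNat_eq_sum]
  -- the summands agree everywhere
  have key : ∀ j, (if stkNum D.wd (y.map cO) / 2 ^ (D.wd * j) % 2 ^ D.wd = D.cT + 2 then 1 else 0) * 2 ^ j =
      (if y.getD j false = true then 1 else 0) * 2 ^ j := by
    intro j
    rcases lt_trichotomy j y.length with hj | rfl | hj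
    · have hj' : j < (y.map cO).length := by simpa using hj
      rw [stkNum_div_pow_mod hsym' hj', List.getElem_map, List.getD_eq_getElem?_getD,
        List.getElem?_eq_getElem hj, Option.getD_some]
      congr 1
      have hb : y[j] ∈ y := List.getElem_mem hj
      by_cases hyj : y[j] = true
      · rw [hyj, hT]; simp
      · rw [if_neg, if_neg hyj]
        intro h
        exact hyj (hfaith _ hb (by omega))
    · rw [← List.length_map (f := cO) (as := y), stkNum_div_pow_length hsym', List.length_map,
        List.getD_eq_getElem?_getD, List.getElem?_eq_none (le_refl _)]
      rw [Nat.mod_eq_of_lt (by omega)]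
      simp
    · have hj' : (y.map cO).length < j := by simpa using hj
      rw [stkNum_div_pow_of_lt hsym' hj' hw, Nat.zero_mod, List.getD_eq_getElem?_getD,
        List.getElem?_eq_none hj.le]
      simp
  simp only [key]
  exact sum_range_eq_of_zero (fun j hj => by
    rw [List.getD_eq_getElem?_getD, List.getElem?_eq_none hj]; simp) hv

/-- **Correctness of the simulation**: if the flat run from the initial configuration on `n`
sits, after `|cap n|` steps, at a configuration whose stack `k₁ < nK` is `y.map cO` with `cO`
faithful on `y` and `cO true = cT`, then `sim n` is the value of `y`. [cite: CookNguyen2010, Thm. VI.2.12, eq. (100)] -/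
theorem sim_eq {n pc : ℕ} {y : List Bool} {cO : Bool → ℕ} (hk₁ : D.k₁ < D.nK)
    (hrun : (step D.P)^[Nat.size (D.cap n)] (D.initC n) = (pc, (List.replicate D.nK []).set D.k₁ (y.map cO)))
    (hfaith : ∀ b ∈ y, cO b = D.cT → b = true) (hT : cO true = D.cT) : D.sim n = bitsToNat y := by
  obtain ⟨h1, h2, h3⟩ := D.run_invariant n (Nat.size (D.cap n)) le_rfl
  have hfin : cfgNum D.wd ((step D.P)^[Nat.size (D.cap n)] (D.initC n)) (D.k₁ + 1) = stkNum D.wd (y.map cO) := by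
    rw [hrun, cfgNum, if_neg (Nat.succ_ne_zero _), Nat.add_sub_cancel, getD_set, List.length_replicate,
      if_pos ⟨rfl, hk₁⟩]
  have hsym : ∀ b ∈ y, cO b + 2 < 2 ^ D.wd := by
    intro b hb
    have := h2 D.k₁ (cO b)
    rw [hrun, getD_set, List.length_replicate, if_pos ⟨rfl, hk₁⟩] at this
    exact this (List.mem_map.2 ⟨b, hb, rfl⟩)
  have hunpk : D.unpk n (D.run n (D.cap n)) (D.k₁ + 1) = stkNum D.wd (y.map cO) := by
    rw [run, D.iterate_pstep_eq n _ le_rfl, unpk, pack_div_mod (fun i _ => h3 i) _ (by omega), hfin]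
  rw [sim, hunpk]
  refine D.decodeAux_stkNum hsym hfaith hT ?_
  -- at least `|y|` digits are read: the code has `w |y| + 1` bits
  have hsym' : ∀ a ∈ y.map cO, a + 2 < 2 ^ D.wd := fun a ha => by
    obtain ⟨b, hb, rfl⟩ := List.mem_map.1 ha; exact hsym b hb
  have hge : 2 ^ (D.wd * y.length) ≤ stkNum D.wd (y.map cO) := by
    have h := stkNum_div_pow_length (w := D.wd) hsym'
    rw [List.length_map] at h
    by_contra hlt
    rw [Nat.div_eq_of_lt (not_le.1 hlt)] at h
    exact zero_ne_one h
  have hw := D.one_le_wd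
  exact ((Nat.le_mul_of_pos_left y.length (by omega : 0 < D.wd)).trans_lt (Nat.lt_size.2 hge)).le

end FlatData

/-! ### Assembly: polynomial time on `TM2` implies `PV`-definability -/

open Turing in
/-- The symbols of the output word of a halting run are allowed symbols of the machine (the
invariant `TM2Std.StkOK` along the run). [folklore] -/
theorem allowed_of_outputsWithin {tm : FinTM2} {L : List (tm.Γ tm.k₀)} {L' : List (tm.Γ tm.k₁)} {t : ℕ}
    (h : Nonempty (TM2OutputsInTime tm L (some L') t)) :
    ∀ γ ∈ L', (⟨tm.k₁, γ⟩ : Σ k, tm.Γ k) ∈ TM2Std.allowed tm := by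
  obtain ⟨⟨⟨s, hev⟩, _⟩⟩ := h
  simp only [Option.map_some] at hev
  have hok := (TM2Std.iterate_tr tm s _ _ (TM2Std.stkOK_initList tm L) hev).2
  intro γ hγ
  have := hok tm.k₁ γ
  rw [TM2Comp.haltList_eq] at this
  exact this (by simpa using hγ)

open Turing FlatProg in
/-- **Cobham's theorem, "only if"** (Cobham 1965; Cook–Nguyen 2010, Thm. VI.2.12 `⟹`): a unary
function computable in polynomial time on binary notation over Mathlib's `TM2` model is the
interpretation of a `PV` symbol. Proof: flat normal form of the machine (`FlatProg.flat_complete`),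
arithmetised by `FlatSim.FlatData.sim` with a clock of length `≥ p(|n|) · haltAddr`.
[cite: Cobham1965] -/
theorem isPVDefinable_of_polyTimeComputable {F : ℕ → ℕ}
    (hF : PolyTimeComputable encodeNat encodeNat F) : IsPVDefinable fun v : Fin 1 → ℕ => F (v 0) := by
  obtain ⟨p, M, hM⟩ := hF
  obtain ⟨a, k, hak⟩ := exists_eval_le_mul_pow_add p
  let cI : Bool → ℕ := fun b =>
    (TM2Std.enc (HaltGuard.guardAux M).tm ⟨(HaltGuard.guardAux M).tm.k₀, M.inputAlphabet.symm b⟩).val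
  let cO : Bool → ℕ := fun b =>
    (TM2Std.enc (HaltGuard.guardAux M).tm ⟨(HaltGuard.guardAux M).tm.k₁, M.outputAlphabet.symm b⟩).val
  let D : FlatData :=
    { P := compile (ucode M), nK := (ucode M).nK, k₀ := (ucode M).k₀, k₁ := (ucode M).k₁,
      pc₀ := entry (ucode M) (ucode M).main (ucode M).init, cI := cI, cT := cO true,
      C := 2 * a * haltAddr (ucode M), d := k }
  refine IsPV₁.congr (f := D.sim) (g := F) D.pv_sim fun n => ?_
  -- the clock lasts long enough
  have hclock : p.eval (encodeNat n).length * haltAddr (ucode M) ≤ Nat.size (D.cap n) := by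
    rw [TM2Pass.length_encodeNat_eq_size]
    set H := haltAddr (ucode M)
    have h1 := hak (Nat.size n)
    have h2 := D.le_size_cap n
    have h3 : Nat.size n ^ k ≤ (Nat.size n + 1) ^ (k + 1) := by
      calc Nat.size n ^ k ≤ (Nat.size n + 1) ^ k := Nat.pow_le_pow_left (Nat.le_succ _) _
        _ ≤ (Nat.size n + 1) ^ (k + 1) := Nat.pow_le_pow_right (Nat.succ_pos _) (Nat.le_succ _)
    have h4 : 1 ≤ (Nat.size n + 1) ^ (k + 1) := Nat.one_le_pow _ _ (Nat.succ_pos _)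
    have h5 : (a * Nat.size n ^ k + a) * H ≤ 2 * a * H * (Nat.size n + 1) ^ (k + 1) := by
      have h6 : a * Nat.size n ^ k + a ≤ a * (Nat.size n + 1) ^ (k + 1) + a * (Nat.size n + 1) ^ (k + 1) :=
        Nat.add_le_add (Nat.mul_le_mul_left a h3) (by simpa using Nat.mul_le_mul_left a h4)
      calc (a * Nat.size n ^ k + a) * H
          ≤ (a * (Nat.size n + 1) ^ (k + 1) + a * (Nat.size n + 1) ^ (k + 1)) * H := Nat.mul_le_mul_right _ h6
        _ = 2 * a * H * (Nat.size n + 1) ^ (k + 1) := by ring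
    calc p.eval (Nat.size n) * H ≤ (a * Nat.size n ^ k + a) * H := Nat.mul_le_mul_right _ h1
      _ ≤ 2 * a * H * (Nat.size n + 1) ^ (k + 1) := h5
      _ ≤ (D.C + 1) * (Nat.size n + 1) ^ (D.d + 1) := Nat.mul_le_mul_right _ (Nat.le_succ _)
      _ ≤ Nat.size (D.cap n) := le_trans (Nat.le_succ _) h2
  -- the flat run, in the form used by the simulation
  have hI : (inCode M (encodeNat n)).map Fin.val = (encodeNat n).map cI := by
    simp only [inCode, TM2Std.stkCode, List.map_map]; rfl
  have hO : (outCode M (encodeNat (F n))).map Fin.val = (encodeNat (F n)).map cO := by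
    simp only [outCode, TM2Std.stkCode, List.map_map]; rfl
  have hflat := flat_complete M (hM n) hclock
  rw [initCfg_eq, haltCfg_eq, hI, hO] at hflat
  have hrun : (step D.P)^[Nat.size (D.cap n)] (D.initC n) =
      (haltAddr (ucode M), (List.replicate D.nK []).set D.k₁ ((encodeNat (F n)).map cO)) := hflat
  -- the output digits are faithful
  have hallowed := allowed_of_outputsWithin ((HaltGuard.outputsWithin_guardAux_iff M).2 (hM n))
  have hfaith : ∀ b ∈ encodeNat (F n), cO b = D.cT → b = true := by
    intro b hb he
    have hmem := hallowed _ (List.mem_map.2 ⟨b, hb, rfl⟩)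
    have he' : TM2Std.enc (HaltGuard.guardAux M).tm ⟨(HaltGuard.guardAux M).tm.k₁, M.outputAlphabet.symm b⟩ =
        TM2Std.enc (HaltGuard.guardAux M).tm ⟨(HaltGuard.guardAux M).tm.k₁, M.outputAlphabet.symm true⟩ :=
      Fin.ext he
    have h1 := TM2Std.eq_of_enc_eq _ hmem he'
    have h2 : M.outputAlphabet.symm b = M.outputAlphabet.symm true := eq_of_heq (Sigma.mk.inj h1).2
    exact M.outputAlphabet.symm.injective h2
  rw [D.sim_eq (ucode M).k₁.isLt hrun hfaith rfl, bitsToNat_encodeNat]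

end FlatSim

/-! ## Part III. Every `PV` symbol is polynomial time (Cobham 1965, "if")

Tuples `v : Fin n → ℕ` are coded as records `⟨encodeNat (v 0), ⟨…, ⟨encodeNat (v (n-1)), []⟩…⟩⟩`
(`codeVec`); a function `F : (Fin n → ℕ) → ℕ` is *polynomial time on codes* (`OnCodes F`) if some
`FP` string function maps `codeVec v` to `encodeNat (F v)`. Every `PVFun.eval` is
(`PVFun.onCodes_eval`), by induction on symbols in the tree's algebra of `FP` bricks; limited
recursion on notation is a counted loop (`Brick.loopStep`) over the bits of the recursion
argument, most significant first. -/

namespace PVPoly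

open Polynomial Brick Plumb

/-! ### Codes of tuples -/

/-- The self-delimiting segment of one field: `boolPair a y = seg a ++ y`. [cite: AroraBarak2009, §0.1] -/
def seg (a : List Bool) : List Bool := (a.flatMap fun b => [b, b]) ++ [false, true]

/-- `boolPair a y = seg a ++ y`. [folklore] -/
theorem boolPair_eq_seg_append (a y : List Bool) : boolPair a y = seg a ++ y := by
  simp [boolPair, seg]

/-- The code of a tuple of numbers: the record of their numerals, last field `[]`.
[cite: CookNguyen2010, §V.4 (sequence coding)] -/
def codeVec {n : ℕ} (v : Fin n → ℕ) : List Bool :=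
  (List.ofFn v).foldr (fun a acc => boolPair (encodeNat a) acc) []

/-- The fold over an appended list. [folklore] -/
theorem foldr_boolPair_append (l : List ℕ) (z : List Bool) :
    l.foldr (fun a acc => boolPair (encodeNat a) acc) z =
      l.foldr (fun a acc => boolPair (encodeNat a) acc) [] ++ z := by
  induction l with
  | nil => rfl
  | cons a l ih => rw [List.foldr_cons, List.foldr_cons, ih, boolPair_eq_seg_append, boolPair_eq_seg_append, List.append_assoc]

/-- The code of the empty tuple. [folklore] -/
@[simp] theorem codeVec_zero (v : Fin 0 → ℕ) : codeVec v = [] := rfl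

/-- The code, first field first. [folklore] -/
theorem codeVec_succ {n : ℕ} (v : Fin (n + 1) → ℕ) :
    codeVec v = boolPair (encodeNat (v 0)) (codeVec (fun i : Fin n => v i.succ)) := by
  rw [codeVec, List.ofFn_succ, List.foldr_cons]; rfl

/-- The code, last field last: `codeVec v = codeVec (init v) ++ seg (encodeNat (v last))`. [folklore] -/
theorem codeVec_eq_init {n : ℕ} (v : Fin (n + 1) → ℕ) :
    codeVec v = codeVec (Fin.init v) ++ seg (encodeNat (v (Fin.last n))) := by
  rw [codeVec, List.ofFn_succ', List.concat_eq_append, List.foldr_append, List.foldr_cons, List.foldr_nil,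
    foldr_boolPair_append, boolPair_eq_seg_append, List.append_nil]
  rfl

/-- The code of an extended tuple. [folklore] -/
theorem codeVec_snoc {n : ℕ} (x : Fin n → ℕ) (y : ℕ) :
    codeVec (Fin.snoc x y : Fin (n + 1) → ℕ) = codeVec x ++ seg (encodeNat y) := by
  rw [codeVec_eq_init, Fin.init_snoc, Fin.snoc_last]

/-- Projections read the fields. [folklore] -/
theorem nthF_codeVec {n : ℕ} (i : Fin n) (v : Fin n → ℕ) : nthF i (codeVec v) = encodeNat (v i) := by
  induction n with
  | zero => exact i.elim0
  | succ n ih =>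
    rw [codeVec_succ]
    cases i using Fin.cases with
    | zero => simp
    | succ j => rw [Fin.val_succ, nthF_succ_boolPair, ih j]

/-! ### Polynomial time on codes -/

/-- `F : ℕⁿ → ℕ` is polynomial time on codes: some `FP` string function maps the code of `v` to
the numeral of `F v`. [cite: Cobham1965] -/
def OnCodes {n : ℕ} (F : (Fin n → ℕ) → ℕ) : Prop :=
  ∃ f : List Bool → List Bool, f ∈ FP ∧ ∀ v, f (codeVec v) = encodeNat (F v)

/-- Building a record from field functions: `⟨G 0 w, ⟨…, ⟨G (m-1) w, []⟩…⟩⟩`. [folklore] -/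
noncomputable def tupleF : {m : ℕ} → (Fin m → (List Bool → List Bool)) → List Bool → List Bool
  | 0, _ => fun _ => []
  | _ + 1, G => fanoutFn (G 0) (tupleF fun i => G i.succ)

/-- `tupleF G ∈ FP` when all fields are. [folklore] -/
theorem tupleF_mem_FP : ∀ {m : ℕ} {G : Fin m → (List Bool → List Bool)}, (∀ i, G i ∈ FP) → tupleF G ∈ FP
  | 0, _, _ => const_mem_FP []
  | _ + 1, _, hG => fanoutFn_mem_FP (hG 0) (tupleF_mem_FP fun i => hG i.succ)

/-- `tupleF` of numeral-valued fields is a code. [folklore] -/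
theorem tupleF_eq_codeVec : ∀ {m : ℕ} (G : Fin m → (List Bool → List Bool)) (w : List Bool) (u : Fin m → ℕ),
    (∀ i, G i w = encodeNat (u i)) → tupleF G w = codeVec u
  | 0, _, _, _, _ => rfl
  | m + 1, G, w, u, h => by
    rw [tupleF, fanoutFn_apply, h 0, codeVec_succ, tupleF_eq_codeVec _ w (fun i => u i.succ) fun i => h i.succ]

/-! ### Numerals: drops, powers of two, minimum -/

/-- Dropping low bits divides: `(encodeNat y).drop c = encodeNat ⌊y / 2^c⌋`. [folklore] -/
theorem drop_encodeNat (c : ℕ) : ∀ y : ℕ, (encodeNat y).drop c = encodeNat (y / 2 ^ c) := by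
  induction c with
  | zero => intro y; simp
  | succ c ih =>
    intro y
    by_cases hy : y = 0
    · subst hy; rw [Nat.zero_div]; rfl
    · have hdec : Nat.bit (Nat.bodd y) (y / 2) = y := by rw [← Nat.div2_val]; exact Nat.bit_bodd_div2 y
      conv_lhs => rw [← hdec, FlatSim.encodeNat_bit _ _ (by rw [hdec]; exact hy)]
      rw [List.drop_succ_cons, ih, Nat.div_div_eq_div_mul, ← pow_succ']

/-- The numeral of a power of two. [folklore] -/
private theorem encodeNat_two_pow (m : ℕ) : encodeNat (2 ^ m) = List.replicate m false ++ [true] := by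
  induction m with
  | zero => rfl
  | succ m ih =>
    have h : 2 ^ (m + 1) = Nat.bit false (2 ^ m) := by rw [Nat.bit_val, pow_succ]; simp; ring
    rw [h, FlatSim.encodeNat_bit _ _ (by rw [← h]; positivity), ih]; rfl

/-- `encodeNat x = []` iff `x = 0`. [folklore] -/
private theorem encodeNat_eq_nil_iff (x : ℕ) : encodeNat x = [] ↔ x = 0 := by
  constructor
  · intro h; have := congrArg bitsToNat h; simpa using this
  · rintro rfl; rfl

/-- The minimum of two numerals, by value. [folklore] -/
private noncomputable def minF : List Bool → List Bool := iteFn ltFn fstF sndF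

/-- `minF ∈ FP`. [folklore] -/
private theorem minF_mem_FP : minF ∈ FP := iteFn_mem_FP ltFn_mem_FP fstF_mem_FP sndF_mem_FP

/-- `minF` on numerals. [folklore] -/
private theorem minF_encodeNat (A B : ℕ) : minF (boolPair (encodeNat A) (encodeNat B)) = encodeNat (min A B) := by
  unfold minF
  by_cases h : A < B
  · rw [iteFn_apply_true (by simp [h]), fstF_boolPair, min_eq_left h.le]
  · rw [iteFn_apply_false (by simp [h]), sndF_boolPair, min_eq_right (not_lt.1 h)]

/-- Output length of an `FP` function is polynomially bounded (`OutputsWithin.length_le`). [folklore] -/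
private theorem exists_poly_length_le {f : List Bool → List Bool} (hf : f ∈ FP) :
    ∃ s : Polynomial ℕ, ∀ x, (f x).length ≤ s.eval x.length := by
  obtain ⟨p, M, hM⟩ := hf
  refine ⟨X + C (TM2Comp.machinePushBound M.tm) * p, fun x => ?_⟩
  have h := (hM x).length_le
  simpa using h

/-! ### The initial symbols and composition -/

/-- `0`. [cite: Cobham1965] -/
theorem onCodes_zero : OnCodes (n := 0) fun _ => 0 := ⟨fun _ => [], const_mem_FP [], fun _ => rfl⟩

/-- Projections. [cite: Cobham1965] -/
theorem onCodes_proj {n : ℕ} (i : Fin n) : OnCodes fun v : Fin n → ℕ => v i :=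
  ⟨nthF i, nthF_mem_FP i, fun v => nthF_codeVec i v⟩

/-- `s_b`: prepend the bit and renormalise. [cite: Cook1975, §2] -/
theorem onCodes_bit (b : Bool) : OnCodes fun v : Fin 1 → ℕ => Nat.bit b (v 0) := by
  refine ⟨norm ∘ List.cons b ∘ nthF 0, comp_mem_FP norm_mem_FP (comp_mem_FP (cons_mem_FP b) (nthF_mem_FP 0)), fun v => ?_⟩
  simp only [Function.comp_apply]
  rw [show nthF 0 (codeVec v) = encodeNat (v 0) from nthF_codeVec 0 v, norm_eq_encodeNat, bitsToNat_cons,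
    bitsToNat_encodeNat, Nat.bit_val]
  congr 1; omega

/-- `⌊·/2⌋`: drop the low bit and renormalise. [cite: Cook1975, §2] -/
theorem onCodes_half : OnCodes fun v : Fin 1 → ℕ => v 0 / 2 := by
  refine ⟨norm ∘ dropFn ∘ fanoutFn (fun _ => [true]) (nthF 0),
    comp_mem_FP norm_mem_FP (comp_mem_FP dropFn_mem_FP (fanoutFn_mem_FP (const_mem_FP _) (nthF_mem_FP 0))), fun v => ?_⟩
  simp only [Function.comp_apply, fanoutFn_apply]
  rw [show nthF 0 (codeVec v) = encodeNat (v 0) from nthF_codeVec 0 v, dropFn_boolPair, List.length_singleton,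
    drop_encodeNat, pow_one, norm_encodeNat]

/-- `|·|`: the length of the numeral, in binary. [cite: Buss1986, §2.2] -/
theorem onCodes_len : OnCodes fun v : Fin 1 → ℕ => Nat.size (v 0) := by
  refine ⟨lenBinF ∘ nthF 0, comp_mem_FP lenBinF_mem_FP (nthF_mem_FP 0), fun v => ?_⟩
  rw [Function.comp_apply, show nthF 0 (codeVec v) = encodeNat (v 0) from nthF_codeVec 0 v, lenBinF_apply,
    TM2Pass.length_encodeNat_eq_size]

/-- `+`. [cite: Buss1986, §2.2] -/
theorem onCodes_add : OnCodes fun v : Fin 2 → ℕ => v 0 + v 1 := by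
  refine ⟨addFn ∘ fanoutFn (nthF 0) (nthF 1), comp_mem_FP addFn_mem_FP (fanoutFn_mem_FP (nthF_mem_FP 0) (nthF_mem_FP 1)),
    fun v => ?_⟩
  rw [Function.comp_apply, fanoutFn_apply, show nthF 0 (codeVec v) = encodeNat (v 0) from nthF_codeVec 0 v,
    show nthF 1 (codeVec v) = encodeNat (v 1) from nthF_codeVec 1 v, addFn_boolPair, bitsToNat_encodeNat,
    bitsToNat_encodeNat]

/-- `·`. [cite: Buss1986, §2.2] -/
theorem onCodes_mul : OnCodes fun v : Fin 2 → ℕ => v 0 * v 1 := by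
  refine ⟨prodFn ∘ fanoutFn (nthF 0) (nthF 1), comp_mem_FP prodFn_mem_FP (fanoutFn_mem_FP (nthF_mem_FP 0) (nthF_mem_FP 1)),
    fun v => ?_⟩
  rw [Function.comp_apply, fanoutFn_apply, show nthF 0 (codeVec v) = encodeNat (v 0) from nthF_codeVec 0 v,
    show nthF 1 (codeVec v) = encodeNat (v 1) from nthF_codeVec 1 v, prodFn_boolPair, bitsToNat_encodeNat,
    bitsToNat_encodeNat]

/-- `cond`: branch on the emptiness of the first numeral. [cite: Cobham1965] -/
theorem onCodes_cond : OnCodes fun v : Fin 3 → ℕ => if v 0 = 0 then v 1 else v 2 := by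
  refine ⟨iteFn (isNilFn ∘ nthF 0) (nthF 1) (nthF 2),
    iteFn_mem_FP (comp_mem_FP isNilFn_mem_FP (nthF_mem_FP 0)) (nthF_mem_FP 1) (nthF_mem_FP 2), fun v => ?_⟩
  have h0 : fstF (codeVec v) = encodeNat (v 0) := nthF_codeVec 0 v
  show _ = encodeNat (if v 0 = 0 then v 1 else v 2)
  by_cases h : v 0 = 0
  · rw [iteFn_apply_true (by simp [isNilFn, h0, h, encodeNat_eq_nil_iff]), if_pos h]
    exact nthF_codeVec 1 v
  · rw [iteFn_apply_false (by simp [isNilFn, h0, h, encodeNat_eq_nil_iff]), if_neg h]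
    exact nthF_codeVec 2 v

/-- **`#`**: `2^{|x||y|}` by a counted loop appending `|x|` zeros `|y|` times to `[1]`.
[cite: Buss1986, §2.2] -/
theorem onCodes_smash : OnCodes fun v : Fin 2 → ℕ => 2 ^ (Nat.size (v 0) * Nat.size (v 1)) := by
  let body : List Bool → List Bool := appF ∘ fanoutFn (Kannan.zerosFn ∘ fstF ∘ fstF) (sndPow 1)
  have hbody : body ∈ FP := comp_mem_FP appF_mem_FP
    (fanoutFn_mem_FP (comp_mem_FP Kannan.zerosFn_mem_FP (comp_mem_FP fstF_mem_FP fstF_mem_FP)) (sndPow_mem_FP 1))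
  have hgrowth : ∀ z, (body z).length ≤ (sndPow 1 z).length + 1 * ((fstF z).length + 1) := by
    intro z
    simp only [body, Function.comp_apply, fanoutFn_apply, appF_boolPair, List.length_append, Kannan.zerosFn_apply,
      List.length_replicate]
    have := length_fstF_sndF_le (fstF z)
    omega
  let mk : List Bool → List Bool :=
    fanoutFn (fanoutFn (nthF 0) (nthF 1)) (fanoutFn (lenBinF ∘ nthF 1) (fun _ => [true]))
  have hmk : mk ∈ FP := fanoutFn_mem_FP (fanoutFn_mem_FP (nthF_mem_FP 0) (nthF_mem_FP 1))
    (fanoutFn_mem_FP (comp_mem_FP lenBinF_mem_FP (nthF_mem_FP 1)) (const_mem_FP _))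
  refine ⟨sndPow 1 ∘ (fun z => (loopStep body)^[(X : Polynomial ℕ).eval (fstF z).length] z) ∘ mk,
    comp_mem_FP (sndPow_mem_FP 1) (comp_mem_FP (loopFn_mem_FP hbody hgrowth X) hmk), fun v => ?_⟩
  have h0 : nthF 0 (codeVec v) = encodeNat (v 0) := nthF_codeVec 0 v
  have h1 : nthF 1 (codeVec v) = encodeNat (v 1) := nthF_codeVec 1 v
  set a := encodeNat (v 0)
  set c := encodeNat (v 1)
  have hmodel : ∀ (k : ℕ) (acc : List Bool), loopModel body (boolPair a c) k acc = List.replicate (k * a.length) false ++ acc := by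
    intro k
    induction k with
    | zero => intro acc; simp [loopModel]
    | succ k ih =>
      intro acc
      rw [loopModel, ih]
      simp only [body, Function.comp_apply, fanoutFn_apply, fstF_boolPair, sndPow_succ_boolPair, sndPow_zero, sndF_boolPair,
        appF_boolPair, Kannan.zerosFn_apply, ← List.append_assoc, ← List.replicate_add]
      congr 2; ring
  simp only [Function.comp_apply, mk, fanoutFn_apply, h0, h1, fstF_boolPair, lenBinF_apply, eval_X]
  rw [iterate_loopStep body _ c.length _ _ (by rw [length_boolPair]; omega), sndPow_succ_boolPair, sndPow_zero,
    sndF_boolPair, hmodel, encodeNat_two_pow, TM2Pass.length_encodeNat_eq_size, TM2Pass.length_encodeNat_eq_size,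
    mul_comm]

/-- **Composition.** [cite: Cobham1965] -/
theorem OnCodes.comp {n m : ℕ} {F : (Fin m → ℕ) → ℕ} {G : Fin m → (Fin n → ℕ) → ℕ} (hF : OnCodes F)
    (hG : ∀ i, OnCodes (G i)) : OnCodes fun v => F fun i => G i v := by
  obtain ⟨f, hf, hfv⟩ := hF
  choose g hg hgv using hG
  refine ⟨f ∘ tupleF g, comp_mem_FP hf (tupleF_mem_FP hg), fun v => ?_⟩
  rw [Function.comp_apply, tupleF_eq_codeVec g (codeVec v) (fun i => G i v) fun i => hgv i v, hfv]


/-! ### Limited recursion on notation as a counted loop -/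

/-- Agreeing functions are polynomial time on codes together. [folklore] -/
theorem OnCodes.of_eq {n : ℕ} {F G : (Fin n → ℕ) → ℕ} (hF : OnCodes F) (h : ∀ v, F v = G v) : OnCodes G := by
  obtain ⟨f, hf, hfv⟩ := hF
  exact ⟨f, hf, fun v => by rw [hfv, h]⟩

/-- The code of the first `n` fields of an `(n+1)`-tuple, rebuilt from projections. [folklore] -/
theorem tupleF_nthF_codeVec {n : ℕ} (v : Fin (n + 1) → ℕ) :
    tupleF (fun i : Fin n => nthF i) (codeVec v) = codeVec (Fin.init v) :=
  tupleF_eq_codeVec _ _ _ fun i => by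
    rw [Fin.init_def, ← nthF_codeVec (Fin.castSucc i) v, Fin.val_castSucc]

/-- **Limited recursion on notation preserves polynomial time on codes** (Cobham 1965; Cook–Nguyen
2010, Thm. VI.2.12 `⟸`): the value `f(x⃗, y)` is computed by a counted loop over the bits of `y`,
most significant first, carrying `f(x⃗, ⌊y/2^c⌋)`; every intermediate value is bounded by a value
of `k`, whence of polynomial length. [cite: Cobham1965] -/
theorem OnCodes.limRec {n : ℕ} (g : PVFun n) (h : Bool → PVFun (n + 2)) (k : PVFun (n + 1))
    (hg : OnCodes g.eval) (hh : ∀ b, OnCodes (h b).eval) (hk : OnCodes k.eval) :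
    OnCodes (PVFun.limRec g h k).eval := by
  obtain ⟨Fg, hFg, hgv⟩ := hg
  choose Fh hFh hhv using hh
  obtain ⟨Fk, hFk, hkv⟩ := hk
  obtain ⟨sk, hsk⟩ := exists_poly_length_le hFk
  -- accessors of the loop record `z = ⟨X, ⟨cnt, ⟨u, acc⟩⟩⟩`, `X = ⟨Y, ⟨XC, pad⟩⟩`
  let YzF : List Bool → List Bool := fstF ∘ fstF
  let XCzF : List Bool → List Bool := nthF 1 ∘ fstF
  let uF : List Bool → List Bool := nthF 2
  let accF : List Bool → List Bool := sndPow 2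
  let u'F : List Bool → List Bool := dropFn ∘ fanoutFn (fun _ => [true]) uF
  let ycF : List Bool → List Bool := dropFn ∘ fanoutFn uF YzF
  let ynF : List Bool → List Bool := dropFn ∘ fanoutFn u'F YzF
  let argHF : List Bool → List Bool := appF ∘ fanoutFn XCzF (fanoutFn ycF (fanoutFn accF fun _ => []))
  let argKF : List Bool → List Bool := appF ∘ fanoutFn XCzF (fanoutFn ynF fun _ => [])
  let nmF : Bool → List Bool → List Bool := fun b => norm ∘ minF ∘ fanoutFn (Fh b ∘ argHF) (Fk ∘ argKF)
  let accRawF : List Bool → List Bool := iteFn (parityFn ∘ ynF) (nmF false) (nmF true)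
  let body : List Bool → List Bool := fanoutFn u'F (clipF 1 accRawF)
  -- the initial record
  let Q : Polynomial ℕ := sk.comp (C 3 * X + C 2)
  let xcF : List Bool → List Bool := tupleF fun i : Fin n => nthF i
  let yF : List Bool → List Bool := nthF n
  let XF : List Bool → List Bool := fanoutFn yF (fanoutFn xcF (polyFn Q))
  let acc0F : List Bool → List Bool :=
    norm ∘ minF ∘ fanoutFn (Fg ∘ xcF) (Fk ∘ appF ∘ fanoutFn xcF fun _ => boolPair [] [])
  let mkF : List Bool → List Bool := fanoutFn XF (fanoutFn (lenBinF ∘ yF) (fanoutFn yF acc0F))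
  -- membership in FP
  have huF : uF ∈ FP := nthF_mem_FP 2
  have hu'F : u'F ∈ FP := comp_mem_FP dropFn_mem_FP (fanoutFn_mem_FP (const_mem_FP _) huF)
  have hYzF : YzF ∈ FP := comp_mem_FP fstF_mem_FP fstF_mem_FP
  have hXCzF : XCzF ∈ FP := comp_mem_FP (nthF_mem_FP 1) fstF_mem_FP
  have hycF : ycF ∈ FP := comp_mem_FP dropFn_mem_FP (fanoutFn_mem_FP huF hYzF)
  have hynF : ynF ∈ FP := comp_mem_FP dropFn_mem_FP (fanoutFn_mem_FP hu'F hYzF)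
  have hargHF : argHF ∈ FP := comp_mem_FP appF_mem_FP
    (fanoutFn_mem_FP hXCzF (fanoutFn_mem_FP hycF (fanoutFn_mem_FP (sndPow_mem_FP 2) (const_mem_FP _))))
  have hargKF : argKF ∈ FP := comp_mem_FP appF_mem_FP (fanoutFn_mem_FP hXCzF (fanoutFn_mem_FP hynF (const_mem_FP _)))
  have hnmF : ∀ b, nmF b ∈ FP := fun b => comp_mem_FP norm_mem_FP
    (comp_mem_FP minF_mem_FP (fanoutFn_mem_FP (comp_mem_FP (hFh b) hargHF) (comp_mem_FP hFk hargKF)))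
  have haccRawF : accRawF ∈ FP := iteFn_mem_FP (comp_mem_FP parityFn_mem_FP hynF) (hnmF false) (hnmF true)
  have hbody : body ∈ FP := fanoutFn_mem_FP hu'F (clipF_mem_FP 1 haccRawF)
  have hxcF : xcF ∈ FP := tupleF_mem_FP fun i => nthF_mem_FP i
  have hacc0F : acc0F ∈ FP := comp_mem_FP norm_mem_FP (comp_mem_FP minF_mem_FP
    (fanoutFn_mem_FP (comp_mem_FP hFg hxcF)
      (comp_mem_FP hFk (comp_mem_FP appF_mem_FP (fanoutFn_mem_FP hxcF (const_mem_FP _))))))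
  have hmkF : mkF ∈ FP := fanoutFn_mem_FP (fanoutFn_mem_FP (nthF_mem_FP n) (fanoutFn_mem_FP hxcF (polyFn_mem_FP Q)))
    (fanoutFn_mem_FP (comp_mem_FP lenBinF_mem_FP (nthF_mem_FP n)) (fanoutFn_mem_FP (nthF_mem_FP n) hacc0F))
  -- growth of the body: linear in the first field, on every input
  have hgrowth : ∀ z, (body z).length ≤ (sndPow 1 z).length + 3 * ((fstF z).length + 1) := by
    intro z
    have h1 : 2 * (nthF 2 z).length + (sndPow 2 z).length ≤ (sndPow 1 z).length :=
      length_nthF_succ_add_sndPow_succ_le 1 z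
    have h2 := length_clipF_le 1 accRawF z
    have h3 : (u'F z).length ≤ (nthF 2 z).length := by
      simp only [u'F, uF, Function.comp_apply, fanoutFn_apply, dropFn_boolPair, List.length_drop]
      omega
    simp only [body]
    rw [length_fanoutFn]
    omega
  refine ⟨sndPow 2 ∘ (fun z => (loopStep body)^[(X : Polynomial ℕ).eval (fstF z).length] z) ∘ mkF,
    comp_mem_FP (sndPow_mem_FP 2) (comp_mem_FP (loopFn_mem_FP hbody hgrowth X) hmkF), fun v => ?_⟩
  -- correctness: write `v = (x⃗, y)`
  have hv : v = Fin.snoc (Fin.init v) (v (Fin.last n)) := (Fin.snoc_init_self v).symm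
  rw [hv]
  generalize Fin.init v = x
  generalize v (Fin.last n) = y
  have hYlen : (encodeNat y).length = Nat.size y := TM2Pass.length_encodeNat_eq_size y
  have hyF : yF (codeVec (Fin.snoc x y : Fin (n + 1) → ℕ)) = encodeNat y := by
    have := nthF_codeVec (Fin.last n) (Fin.snoc x y : Fin (n + 1) → ℕ)
    rwa [Fin.val_last, Fin.snoc_last] at this
  have hxcF : xcF (codeVec (Fin.snoc x y : Fin (n + 1) → ℕ)) = codeVec x := by
    have := tupleF_nthF_codeVec (Fin.snoc x y : Fin (n + 1) → ℕ)
    rwa [Fin.init_snoc] at this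
  have hw : codeVec (Fin.snoc x y : Fin (n + 1) → ℕ) = codeVec x ++ seg (encodeNat y) := codeVec_snoc x y
  -- abbreviations (plain terms)
  have hT0 : (PVFun.limRec g h k).eval (Fin.snoc x 0) = min (g.eval x) (k.eval (Fin.snoc x 0)) :=
    PVFun.eval_limRec_zero g h k x
  have hcode2 : ∀ (q a : ℕ), codeVec x ++ boolPair (encodeNat q) (boolPair (encodeNat a) []) =
      codeVec (Fin.snoc (Fin.snoc x q) a : Fin (n + 2) → ℕ) := by
    intro q a
    rw [codeVec_snoc, codeVec_snoc, boolPair_eq_seg_append, boolPair_eq_seg_append, List.append_nil, List.append_assoc]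
  have hcode1 : ∀ q : ℕ, codeVec x ++ boolPair (encodeNat q) [] = codeVec (Fin.snoc x q : Fin (n + 1) → ℕ) := by
    intro q
    rw [codeVec_snoc, boolPair_eq_seg_append, List.append_nil]
  have hcode10 : codeVec x ++ boolPair [] [] = codeVec (Fin.snoc x 0 : Fin (n + 1) → ℕ) := hcode1 0
  -- the initial accumulator and record
  have hacc0 : acc0F (codeVec (Fin.snoc x y : Fin (n + 1) → ℕ)) = encodeNat ((PVFun.limRec g h k).eval (Fin.snoc x 0)) := by
    simp only [acc0F, Function.comp_apply, fanoutFn_apply, hxcF, appF_boolPair]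
    rw [hgv, hcode10, hkv, minF_encodeNat, norm_encodeNat, hT0]
  have hmk : mkF (codeVec (Fin.snoc x y : Fin (n + 1) → ℕ)) =
      boolPair (boolPair (encodeNat y) (boolPair (codeVec x) (polyFn Q (codeVec (Fin.snoc x y : Fin (n + 1) → ℕ)))))
        (boolPair (encodeNat (Nat.size y)) (boolPair (encodeNat y) (encodeNat ((PVFun.limRec g h k).eval (Fin.snoc x 0))))) := by
    simp only [mkF, XF, fanoutFn_apply, Function.comp_apply, hyF, hxcF, hacc0, lenBinF_apply, hYlen]
  -- the padded first field and the bound it provides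
  generalize hP : polyFn Q (codeVec (Fin.snoc x y : Fin (n + 1) → ℕ)) = pad at hmk
  have hpadlen : pad.length = sk.eval (3 * (codeVec (Fin.snoc x y : Fin (n + 1) → ℕ)).length + 2) := by
    rw [← hP, polyFn_apply]; simp [Q, ones]
  generalize hXr : boolPair (encodeNat y) (boolPair (codeVec x) pad) = Xr at hmk
  have hXrlen : pad.length ≤ Xr.length ∧ (encodeNat y).length ≤ Xr.length := by
    rw [← hXr, length_boolPair, length_boolPair]; omega
  have hXClen : (codeVec x).length + (seg (encodeNat y)).length = (codeVec (Fin.snoc x y : Fin (n + 1) → ℕ)).length := by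
    rw [hw, List.length_append]
  have hseglen : ∀ a : List Bool, (seg a).length = 2 * a.length + 2 := by
    intro a
    have := length_boolPair a []
    rw [boolPair_eq_seg_append, List.append_nil] at this
    simpa using this
  -- one round of the body on the intended records
  have hbody_apply : ∀ (c : ℕ) (cnt : List Bool), c + 1 ≤ Nat.size y →
      body (boolPair Xr (boolPair cnt (boolPair ((encodeNat y).drop (Nat.size y - (c + 1)))
        (encodeNat ((PVFun.limRec g h k).eval (Fin.snoc x (y / 2 ^ (c + 1)))))))) =
        boolPair ((encodeNat y).drop (Nat.size y - c)) (encodeNat ((PVFun.limRec g h k).eval (Fin.snoc x (y / 2 ^ c)))) := by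
    intro c cnt hc
    -- the two truncations of `y` and the bit between them
    have hrq : y / 2 ^ c / 2 = y / 2 ^ (c + 1) := by rw [Nat.div_div_eq_div_mul, ← pow_succ]
    have hr0 : y / 2 ^ c ≠ 0 := by
      have : 2 ^ c ≤ y := Nat.lt_size.1 (by omega)
      exact Nat.ne_of_gt (Nat.div_pos this (by positivity))
    have hbit : Nat.bit (Nat.bodd (y / 2 ^ c)) (y / 2 ^ (c + 1)) = y / 2 ^ c := by
      rw [← hrq, ← Nat.div2_val]; exact Nat.bit_bodd_div2 _
    have hu : ((encodeNat y).drop (Nat.size y - (c + 1))).length = c + 1 := by rw [List.length_drop, hYlen]; omega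
    have hu' : ((encodeNat y).drop (Nat.size y - (c + 1))).drop 1 = (encodeNat y).drop (Nat.size y - c) := by
      have e : Nat.size y - (c + 1) + 1 = Nat.size y - c := by omega
      rw [List.drop_drop, e]
    have hu'len : ((encodeNat y).drop (Nat.size y - c)).length = c := by rw [List.length_drop, hYlen]; omega
    have hyc : (encodeNat y).drop (c + 1) = encodeNat (y / 2 ^ (c + 1)) := drop_encodeNat (c + 1) y
    have hyn : (encodeNat y).drop c = encodeNat (y / 2 ^ c) := drop_encodeNat c y
    have hTr : (PVFun.limRec g h k).eval (Fin.snoc x (y / 2 ^ c)) =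
        min ((h (Nat.bodd (y / 2 ^ c))).eval (Fin.snoc (Fin.snoc x (y / 2 ^ (c + 1)))
          ((PVFun.limRec g h k).eval (Fin.snoc x (y / 2 ^ (c + 1))))))
          (k.eval (Fin.snoc x (y / 2 ^ c))) := by
      have hTr' := PVFun.eval_limRec_bit g h k x (Nat.bodd (y / 2 ^ c)) (y / 2 ^ (c + 1)) fun hq0 => by
        by_contra hbf
        apply hr0
        rw [← hbit, hq0, Bool.eq_false_iff.2 hbf]; rfl
      rw [hbit] at hTr'
      exact hTr'
    -- name the record
    generalize hz : boolPair Xr (boolPair cnt (boolPair ((encodeNat y).drop (Nat.size y - (c + 1)))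
        (encodeNat ((PVFun.limRec g h k).eval (Fin.snoc x (y / 2 ^ (c + 1))))))) = z
    -- evaluate the accessors
    have eU' : u'F z = (encodeNat y).drop (Nat.size y - c) := by
      rw [← hz]
      simp only [u'F, uF, Function.comp_apply, fanoutFn_apply, nthF_succ_boolPair, nthF_zero_boolPair, dropFn_boolPair,
        List.length_singleton, hu']
    have eYc : ycF z = encodeNat (y / 2 ^ (c + 1)) := by
      rw [← hz, ← hXr]
      simp only [ycF, uF, YzF, Function.comp_apply, fanoutFn_apply, nthF_succ_boolPair, nthF_zero_boolPair,
        fstF_boolPair, dropFn_boolPair, hu, hyc]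
    have eYn : ynF z = encodeNat (y / 2 ^ c) := by
      have e1 : ynF z = (fstF (fstF z)).drop (u'F z).length := by
        simp only [ynF, YzF, Function.comp_apply, fanoutFn_apply, dropFn_boolPair]
      rw [e1, eU', hu'len, ← hz, fstF_boolPair, ← hXr, fstF_boolPair, hyn]
    have eXC : XCzF z = codeVec x := by
      rw [← hz, ← hXr]; simp only [XCzF, Function.comp_apply, fstF_boolPair, nthF_succ_boolPair, nthF_zero_boolPair]
    have eAcc : accF z = encodeNat ((PVFun.limRec g h k).eval (Fin.snoc x (y / 2 ^ (c + 1)))) := by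
      rw [← hz]; simp only [accF, sndPow_succ_boolPair, sndPow_zero, sndF_boolPair]
    have eH : argHF z = codeVec (Fin.snoc (Fin.snoc x (y / 2 ^ (c + 1)))
        ((PVFun.limRec g h k).eval (Fin.snoc x (y / 2 ^ (c + 1)))) : Fin (n + 2) → ℕ) := by
      simp only [argHF, Function.comp_apply, fanoutFn_apply, eYc, eXC, eAcc, appF_boolPair, hcode2]
    have eK : argKF z = codeVec (Fin.snoc x (y / 2 ^ c) : Fin (n + 1) → ℕ) := by
      simp only [argKF, Function.comp_apply, fanoutFn_apply, eYn, eXC, appF_boolPair, hcode1]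
    have eNm : nmF (Nat.bodd (y / 2 ^ c)) z = encodeNat ((PVFun.limRec g h k).eval (Fin.snoc x (y / 2 ^ c))) := by
      simp only [nmF, Function.comp_apply, fanoutFn_apply, eH, eK, hhv, hkv, minF_encodeNat, norm_encodeNat, hTr]
    have hpar : (parityFn ∘ ynF) z = [!(Nat.bodd (y / 2 ^ c))] := by
      rw [Function.comp_apply, eYn]
      simp only [parityFn, bitsToNat_encodeNat, Nat.even_iff, Nat.mod_two_of_bodd]
      cases Nat.bodd (y / 2 ^ c) <;> rfl
    have eRaw : accRawF z = encodeNat ((PVFun.limRec g h k).eval (Fin.snoc x (y / 2 ^ c))) := by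
      rw [← eNm]
      simp only [accRawF]
      cases hb : Nat.bodd (y / 2 ^ c) with
      | false => exact iteFn_apply_true (by rw [hpar, hb]; rfl)
      | true => exact iteFn_apply_false (by rw [hpar, hb]; rfl)
    -- unclipping: the new accumulator is at most as long as the value of `k`
    have eClip : clipF 1 accRawF z = encodeNat ((PVFun.limRec g h k).eval (Fin.snoc x (y / 2 ^ c))) := by
      rw [← eRaw]
      apply clipF_eq_self
      rw [eRaw, ← hz, fstF_boolPair, one_mul]
      have h1 : (encodeNat ((PVFun.limRec g h k).eval (Fin.snoc x (y / 2 ^ c)))).length ≤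
          (Fk (codeVec (Fin.snoc x (y / 2 ^ c) : Fin (n + 1) → ℕ))).length := by
        rw [hkv, hTr]; exact length_encodeNat_mono (min_le_right _ _)
      have h2 := hsk (codeVec (Fin.snoc x (y / 2 ^ c) : Fin (n + 1) → ℕ))
      have h3 : (codeVec (Fin.snoc x (y / 2 ^ c) : Fin (n + 1) → ℕ)).length ≤
          3 * (codeVec (Fin.snoc x y : Fin (n + 1) → ℕ)).length + 2 := by
        rw [codeVec_snoc, List.length_append, hseglen, ← hXClen, hseglen]
        have h4 : (encodeNat (y / 2 ^ c)).length ≤ (encodeNat y).length := length_encodeNat_mono (Nat.div_le_self _ _)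
        omega
      have h5 := TM2Iter.eval_mono sk h3
      omega
    rw [← hz]
    simp only [body, fanoutFn_apply]
    rw [hz, eU', eClip]
  -- the model of the loop
  have hmodel : ∀ c, c ≤ Nat.size y →
      loopModel body Xr c (boolPair ((encodeNat y).drop (Nat.size y - c))
        (encodeNat ((PVFun.limRec g h k).eval (Fin.snoc x (y / 2 ^ c))))) =
        boolPair ((encodeNat y).drop (Nat.size y)) (encodeNat ((PVFun.limRec g h k).eval (Fin.snoc x y))) := by
    intro c
    induction c with
    | zero => intro; simp [loopModel]
    | succ c ih => intro hc; rw [loopModel, hbody_apply c _ hc]; exact ih (by omega)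
  -- assembling
  have hym : y / 2 ^ Nat.size y = 0 := Nat.div_eq_of_lt (Nat.lt_size_self y)
  have hm_le : Nat.size y ≤ Xr.length := by rw [← hYlen]; exact hXrlen.2
  simp only [Function.comp_apply]
  rw [hmk, fstF_boolPair, eval_X, iterate_loopStep body Xr (Nat.size y) _ _ hm_le]
  have h0 := hmodel (Nat.size y) le_rfl
  rw [Nat.sub_self, List.drop_zero, hym] at h0
  rw [h0, sndPow_succ_boolPair, sndPow_succ_boolPair, sndPow_zero, sndF_boolPair]

/-- **Every `PV` symbol is polynomial time on codes** (Cobham 1965, "if"; Cook–Nguyen 2010,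
Thm. VI.2.12 `⟸`), by induction on symbols. [cite: Cobham1965] -/
theorem onCodes_eval : ∀ {n : ℕ} (f : PVFun n), OnCodes f.eval
  | _, .zero => onCodes_zero.of_eq fun v => (PVFun.eval_zero v).symm
  | _, .proj i => (onCodes_proj i).of_eq fun v => (PVFun.eval_proj i v).symm
  | _, .bit b => (onCodes_bit b).of_eq fun v => (PVFun.eval_bit b v).symm
  | _, .half => onCodes_half.of_eq fun v => (PVFun.eval_half v).symm
  | _, .len => onCodes_len.of_eq fun v => (PVFun.eval_len v).symm
  | _, .smash => onCodes_smash.of_eq fun v => (PVFun.eval_smash v).symm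
  | _, .add => onCodes_add.of_eq fun v => (PVFun.eval_add v).symm
  | _, .mul => onCodes_mul.of_eq fun v => (PVFun.eval_mul v).symm
  | _, .cond => onCodes_cond.of_eq fun v => (PVFun.eval_cond v).symm
  | _, .comp f g => ((onCodes_eval f).comp fun i => onCodes_eval (g i)).of_eq fun v => (PVFun.eval_comp f g v).symm
  | _, .limRec g h k => OnCodes.limRec g h k (onCodes_eval g) (fun b => onCodes_eval (h b)) (onCodes_eval k)

end PVPoly

/-! ## Cobham's theorem -/

/-- **Cobham's theorem, "if"** (Cobham 1965; Cook–Nguyen 2010, Thm. VI.2.12 `⟸`): the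
interpretation of a unary `PV` symbol is computable in polynomial time on binary notation over
Mathlib's `TM2` model. [cite: Cobham1965] -/
theorem polyTimeComputable_of_isPVDefinable {F : ℕ → ℕ} (hF : IsPVDefinable fun v : Fin 1 → ℕ => F (v 0)) :
    PolyTimeComputable encodeNat encodeNat F := by
  obtain ⟨f, hf⟩ := hF
  obtain ⟨φ, hφ, hφv⟩ := PVPoly.onCodes_eval f
  have hid : (id : List Bool → List Bool) ∈ FP := PolyTimeComputable.id _
  obtain ⟨p, M, hM⟩ := comp_mem_FP hφ (fanoutFn_mem_FP hid (const_mem_FP []))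
  refine ⟨p, M, fun a => ?_⟩
  have h := hM (encodeNat a)
  have hcode : fanoutFn id (fun _ => []) (encodeNat a) = PVPoly.codeVec (fun _ : Fin 1 => a) := by
    rw [fanoutFn_apply, PVPoly.codeVec_succ, PVPoly.codeVec_zero]; rfl
  simp only [id, Function.comp_apply] at h
  rw [hcode, hφv, hf] at h
  exact h

/-- **Cobham's theorem** (Cobham 1965; Krajíček 1995, Thm. 5.3.1; Cook–Nguyen 2010, Thm. VI.2.12):
discharge of the named fact `cobham` — a unary function is the interpretation of a `PV` symbol iff
it is polynomial-time computable on binary notation over Mathlib's `TM2` model. [cite: Cobham1965] -/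
theorem cobham_holds : cobham := fun _ =>
  ⟨polyTimeComputable_of_isPVDefinable, FlatSim.isPVDefinable_of_polyTimeComputable⟩


end Literature.Analysis.FunctionSpaces
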